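import Mathlib.Algebra.Order.Field.GeomSum
import Mathlib.Analysis.InnerProductSpace.PiL2
import Literature.Computability.Complexity.BooleanFourier
import Literature.Computability.Complexity.CircuitRestriction
import Literature.Computability.QuantumComplexity.RazTalForrelation
import HarnessLib

/-!
# `𝒟` fools bounded-depth circuits: Raz–Tal, Theorem 7.4 from Tal's Fourier tail bound

Topic `Literature/Computability/QuantumComplexity`; continuation of file `RazTalForrelation`
(the Raz–Tal distribution `𝒟`, Corollary 6.4 proved, and the assembly
`raz_tal_forrelation_of_thm74 : RazTal2022_thm74 → raz_tal_forrelation` of the named fact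
**quantum-advantage.S15**). Source: R. Raz, A. Tal, *Oracle separation of BQP and PH*, J. ACM 69
(2022), Art. 30, §7 (ECCC TR18-107 has the same numbering). This file proves **Theorem 7.4**
(`𝒟` fools AC⁰) from **Lemma 7.1** (Tal, CCC 2017, Thm 37; the named fact `Tal2017_fourierL1_ac0`
of file `RazTalForrelation`), whence

* `razTal2022_thm74_of_tal : Tal2017_fourierL1_ac0 → RazTal2022_thm74`,
* `raz_tal_forrelation_of_tal : Tal2017_fourierL1_ac0 → raz_tal_forrelation`:
  after this file S15 rests only on Tal's switching-lemma-based tail bound, as printed.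

The paper applies Lemma 7.1 to the *restrictions* `A_ρ` of the circuit (proof of Claim 7.3); the
argument is first run from the restriction-closed form of the lemma taken as explicit hypotheses
(`razTal2022_thm74_of_tal_restr`), and that form is derived from the plain named fact
(`tal2017_fourierL1_ac0_restr_of_plain`) by the closure of `acBasis` circuits under restriction,
`Circuit.exists_restrict` of file `Literature/Computability/Complexity/CircuitRestriction`.
No new named fact is introduced.

Contents, following §7 of the paper:

* Fourier expansion on the cube: the coefficients `cubeFourierCoeff`, inversion and the
  coefficients of restrictions `x ↦ g (J.piecewise σ x)` (Mathlib's `Finset.piecewise`) come from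
  `Literature.Computability.Complexity.BooleanFourier` (O'Donnell 2014, Ch. 1, 3); here the bridge
  `boolFourierCoeff f = cubeFourierCoeff (χ ∘ f)` (`rfl`), the multilinear extension
  (`multilinearEval (cubeFourierCoeff g)` agrees with `g` on the cube, Eq. (4)) and the identity
  `g̃_{J,σ}(y) = g̃(ỹ)` (`multilinearEval_restrict`) behind "`A(z̃(z,ρ)) = A_ρ(P ∘ z)`".
* Moments of `𝒢'` (Claim 4.1 in the form used by the proof of Claim 7.2): `𝒢'` is symmetric
  (`razTalGaussian_map_neg`), so odd moments vanish (`gaussMoment_eq_zero_of_odd`); the level-2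
  moments are the covariances, `|Ĝ'({k,l})| ≤ ε N^{-1/2}` (`abs_gaussMoment_pair_le`); and
  `|Ĝ'(S)| ≤ ε^{|S|/2}` for all `S` (`abs_gaussMoment_le`, Claim 4.1(4) by a weighted AM–GM
  inequality and the block laws of file `RazTalForrelation`).
* **Claim 7.2** (`razTal_claim72`), with the hypothesis `q² ≤ N^{-1/2}` (`q = p√ε L`) added to
  the paper's `q ≤ 1/2`: it holds in the claim's only application (proof of Theorem 7.4, where
  `q ≤ N^{-1/4}/4`) and lets Claim 4.1(4) replace the Isserlis bound `ℓ! N^{-ℓ/2}` at levels `≥ 4`.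
* **Claim 7.3** (`razTal_claim73`): the random restriction `ρ ∼ R_{z₀}` (`restrictWeight`,
  `restrictPoint`), `𝔼_ρ F(z̃(z,ρ)) = F(z₀ + p z)` (`sum_restrictWeight_mul_multilinearEval`),
  and Claim 7.2 for each restriction.
* The Gaussian random walk of the proof of Theorem 7.4: `a z + b z' ∼ √(a²+b²) z` for
  independent `z, z' ∼ 𝒢'` (`razTalGaussian_prod_map_add`, from the rotation invariance of
  `𝒩(0, I_{2N})` on `ℝ^{[N] ⊔ [N]}` and Mathlib's `measurePreserving_sumPiEquivProdPi`), the exit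
  bound `Pr_{𝒢'}[∃k, |z_k| > 1/2] ≤ 4N^{-2}` (`integral_halfExitInd_le`), the step estimate
  (`walk_step_inside`: Claim 5.3 with `p₀ = 1/2` plus Claim 7.3; `abs_walkMean_succ_sub_le`), and
  the telescoped bound `|𝔼_{𝒢'} g̃(trnc z) − ĝ(∅)| ≤ 12 ε L² N^{-1/2} + 16 N^{-1}`
  (`abs_integral_truncEval_sub_le`, `t = N` steps, `p = N^{-1/2}`).
* Eq. (2) for arbitrary `g` (`sum_razTalDistribution_mul`), the closing numerics
  (`eight_div_le_ten_eps`, `n ≥ 20`), and the assembly `razTal2022_thm74_of_tal_restr` with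
  `c = max(c_Tal, 2)`, `n₀ = 20`; the case `16 ε L² > √N` is the paper's "otherwise the claim is
  vacuous".

Model remark (Lemma 7.1 for restrictions). Raz–Tal apply Lemma 7.1 to the restrictions `A_ρ`,
noting that "restrictions of `A` are also Boolean circuits of size at most `s` and depth at most
`d`" (proof of Claim 7.3). In H21's straight-line circuits (`Literature.Computability.Complexity.Circuit` over `acBasis`,
depth `acDepth`, `size` = number of gates) inputs cannot be hard-wired for free: a constant is a
gate `∧₀`/`∨₀` of `acDepth`-weight `1`, so restriction preserves size and depth only up to
`max(·, 1)` (`Circuit.exists_restrict`, constant propagation in straight-line programs) — harmless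
for the bound `(c log s)^{(d-1)k}` with `s ≥ 2` and `d - 1` truncated in `ℕ`
(`tal2017_fourierL1_ac0_restr_of_plain`; the bridge `restrictInput ρ_{J,σ} = J.piecewise σ`
between the restriction encodings of files `CircuitRestriction` and `BooleanFourier` is
`restrictInput_ofPiecewise`). The half-cube indicators `halfExitInd`/`halfTailInd` are the cube
indicators `cubeExitInd`/`coordTailInd` of file `RazTalForrelation` at the doubled point.
-/

namespace Literature.Computability.QuantumComplexity

open MeasureTheory ProbabilityTheory Finset Matrix Complexity Complexity.LowDegree Literature.Probability.RandomGraphs.LowDegree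
open scoped NNReal

/-! ## Part II. `𝒟` fools bounded-depth circuits (Raz–Tal, §7)

The second half of Theorem 1.1: Theorem 7.4 from Tal's Fourier tail bound (Lemma 7.1), through
the moments of `𝒢'` (Claim 4.1), Claim 7.2 (one Gaussian step at scale `p` moves a function with
small Fourier tails by `O(ε p² L² N^{-1/2})`), Claim 7.3 (the same from a base point
`z₀ ∈ [-1/2,1/2]^{2N}`, by a random restriction), and the `t = N`-step Gaussian random walk
`z^{≤(i)} = p (z^{(1)} + ⋯ + z^{(i)})`, `p = N^{-1/2}`, of the proof of Theorem 7.4. -/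

/-! ### Fourier expansion on the cube -/

section Fourier

variable {m : ℕ}

/-- `boolFourierCoeff f = cubeFourierCoeff (χ ∘ f)`. [cite: ODonnell2014, §1.2] -/
theorem boolFourierCoeff_eq_cubeFourierCoeff (f : (Fin m → Bool) → Bool) :
    boolFourierCoeff f = cubeFourierCoeff (fun x => sgn (f x)) := rfl

/-- A multilinear function at a cube point is its Fourier–Walsh series there. [folklore] -/
theorem multilinearEval_sgn (c : Finset (Fin m) → ℝ) (w : Fin m → Bool) :
    multilinearEval c (fun i => sgn (w i)) = ∑ S, c S * walsh S w := rfl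

/-- **The multilinear extension**: the multilinear function with coefficients `ĝ` agrees with
`g` on the cube (Raz–Tal, §7, Eq. (4)). [cite: RazTalJACM2022, §7 Eq. (4)] -/
theorem multilinearEval_cubeFourierCoeff_sgn (g : (Fin m → Bool) → ℝ) (w : Fin m → Bool) :
    multilinearEval (cubeFourierCoeff g) (fun i => sgn (w i)) = g w := by
  rw [multilinearEval_sgn, sum_cubeFourierCoeff_mul_walsh]

/-- The multilinear extension at the origin is `ĝ(∅)`. [cite: RazTalJACM2022, §7] -/
theorem multilinearEval_zero (c : Finset (Fin m) → ℝ) :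
    multilinearEval c (fun _ => (0 : ℝ)) = c ∅ := by
  classical
  unfold multilinearEval
  rw [Finset.sum_eq_single_of_mem ∅ (Finset.mem_univ _)]
  · simp
  · intro S _ hS
    obtain ⟨i, hi⟩ := Finset.nonempty_iff_ne_empty.2 hS
    rw [Finset.prod_eq_zero hi rfl, mul_zero]

/-! #### Restrictions -/

/-- **The multilinear extension of a restriction is the restriction of the multilinear
extension**: `g̃_{J,σ}(y) = g̃(ỹ)` with `ỹᵢ = χ(σᵢ)` on `J` and `yᵢ` elsewhere (Raz–Tal, proof of
Claim 7.3: "`A(z̃(z, ρ)) = A_ρ(P ∘ z)`"). [cite: RazTalJACM2022, Claim 7.3] -/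
theorem multilinearEval_restrict (g : (Fin m → Bool) → ℝ) (J : Finset (Fin m))
    (σ : Fin m → Bool) (y : Fin m → ℝ) :
    multilinearEval (cubeFourierCoeff fun x => g (J.piecewise σ x)) y =
      multilinearEval (cubeFourierCoeff g) (fun i => if i ∈ J then sgn (σ i) else y i) := by
  unfold multilinearEval
  simp_rw [cubeFourierCoeff_piecewise, Finset.sum_mul]
  rw [Finset.sum_comm]
  refine Finset.sum_congr rfl fun S _ => ?_
  simp_rw [ite_mul, zero_mul]
  rw [Finset.sum_ite_eq]
  simp only [Finset.mem_univ, if_true]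
  rw [Finset.prod_ite, mul_assoc]

end Fourier

/-! ### Moments of `𝒢'` (Claim 4.1) -/

section Moments

variable (n : ℕ)

/-- The moment `Ĝ'(S) = 𝔼_{z∼𝒢'} ∏_{k∈S} z_k` of the scaled Gaussian (Raz–Tal, §4.1: "these are
actually the moments of `𝒢`"; here for `𝒢' = √ε 𝒢`, so `Ĝ'(S) = ε^{|S|/2} Ĝ(S)`). [cite: RazTalJACM2022, §4.1] -/
noncomputable def gaussMoment (S : Finset (Fin (2 * 2 ^ n))) : ℝ :=
  ∫ z, ∏ k ∈ S, z k ∂(razTalGaussian n)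

/-- `𝒩(0, I_N)` is symmetric: invariant under `x ↦ -x`. [folklore] -/
theorem stdGaussianPi_map_neg (N : ℕ) :
    (stdGaussianPi N).map (fun x => -x) = stdGaussianPi N := by
  have h := pi_gaussianReal_map_mulVec (ι := Fin N) (-1 : Matrix (Fin N) (Fin N) ℝ) (by simp)
  have e : (-1 : Matrix (Fin N) (Fin N) ℝ).mulVec = fun x => -x := by
    funext x; rw [Matrix.neg_mulVec, Matrix.one_mulVec]
  rw [e] at h
  exact h

/-- The sample map is odd (linear). [folklore] -/
theorem razTalSample_neg (x : Fin (2 ^ n) → ℝ) : razTalSample n (-x) = -razTalSample n x := by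
  funext k
  simp only [razTalSample_eq, Pi.neg_apply, mul_neg, Finset.sum_neg_distrib]

/-- **`𝒢'` is symmetric**: invariant under `z ↦ -z` (zero-mean Gaussian; Raz–Tal, §4.1). [cite: RazTalJACM2022, §4.1] -/
theorem razTalGaussian_map_neg : (razTalGaussian n).map (fun z => -z) = razTalGaussian n := by
  rw [razTalGaussian, Measure.map_map (by fun_prop) (continuous_razTalSample n).measurable]
  have : (fun z : Fin (2 * 2 ^ n) → ℝ => -z) ∘ razTalSample n = razTalSample n ∘ fun x => -x := by
    funext x
    simp only [Function.comp_apply, razTalSample_neg]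
  rw [this, ← Measure.map_map (continuous_razTalSample n).measurable (by fun_prop),
    stdGaussianPi_map_neg]

/-- **Claim 4.1(2), odd part**: moments of odd order vanish, `Ĝ'(S) = 0` for `|S|` odd
(Raz–Tal, Claim 4.1(2) gives more: `Ĝ(S,T) = 0` unless `|S ∩ x| = |S ∩ y|`; the odd case, by the
symmetry `z ↦ -z`, is what the proof of Claim 7.2 uses at odd levels). [cite: RazTalJACM2022, Claim 4.1] -/
theorem gaussMoment_eq_zero_of_odd (S : Finset (Fin (2 * 2 ^ n))) (hS : Odd S.card) :
    gaussMoment n S = 0 := by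
  unfold gaussMoment
  have h : ∫ z, ∏ k ∈ S, z k ∂(razTalGaussian n) =
      ∫ z, ∏ k ∈ S, (-z) k ∂(razTalGaussian n) := by
    conv_lhs => rw [← razTalGaussian_map_neg n]
    rw [integral_map (by fun_prop : Measurable fun z : Fin (2 * 2 ^ n) → ℝ => -z).aemeasurable]
    exact Continuous.aestronglyMeasurable (by fun_prop)
  have h2 : ∀ z : Fin (2 * 2 ^ n) → ℝ, ∏ k ∈ S, (-z) k = (-1) ^ S.card * ∏ k ∈ S, z k := by
    intro z
    simp only [Pi.neg_apply]
    rw [Finset.prod_neg]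
  simp_rw [h2, integral_const_mul, hS.neg_one_pow] at h
  linarith

/-- Every index of `[2N]` is an `xᵢ` or a `yⱼ`. [folklore] -/
theorem exists_xIdx_or_yIdx (k : Fin (2 * 2 ^ n)) :
    (∃ i, k = xIdx n i) ∨ (∃ j, k = yIdx n j) := by
  obtain ⟨a, ha⟩ : ∃ a, (splitIndex (2 ^ n)).symm a = k := ⟨_, Equiv.symm_apply_apply _ k⟩
  rcases a with i | j
  · exact Or.inl ⟨i, ha.symm⟩
  · exact Or.inr ⟨j, ha.symm⟩

/-- `|(H_N)_{ij}| = N^{-1/2}`. [cite: RazTalJACM2022, §3.1] -/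
theorem abs_hadamardMatrix (i j : Fin (2 ^ n)) :
    |hadamardMatrix n i j| = 1 / Real.sqrt ((2 ^ n : ℕ) : ℝ) := by
  unfold hadamardMatrix
  rw [abs_div, abs_hadamardSign, abs_of_nonneg (Real.sqrt_nonneg _)]
  push_cast
  rfl

/-- **Claim 4.1(1)–(2) at level two**: `|Ĝ'({k, l})| ≤ ε N^{-1/2}` for `k ≠ l` (the covariance
matrix `ε [[I, H], [H, I]]` has off-diagonal entries `0` or `±ε N^{-1/2}`). [cite: RazTalJACM2022, Claim 4.1] -/
theorem abs_gaussMoment_pair_le {k l : Fin (2 * 2 ^ n)} (hkl : k ≠ l) :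
    |gaussMoment n {k, l}| ≤ razTalEps (2 ^ n) / Real.sqrt ((2 ^ n : ℕ) : ℝ) := by
  have hε := razTalEps_nonneg (2 ^ n)
  have hb : 0 ≤ razTalEps (2 ^ n) / Real.sqrt ((2 ^ n : ℕ) : ℝ) := by positivity
  unfold gaussMoment
  simp_rw [Finset.prod_pair hkl]
  rcases exists_xIdx_or_yIdx n k with ⟨i, rfl⟩ | ⟨j, rfl⟩ <;>
    rcases exists_xIdx_or_yIdx n l with ⟨i', rfl⟩ | ⟨j', rfl⟩
  · rw [integral_x_mul_x]
    have : i ≠ i' := fun h => hkl (h ▸ rfl)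
    simpa [this] using hb
  · rw [integral_x_mul_y, abs_mul, abs_of_nonneg hε, abs_hadamardMatrix, ← div_eq_mul_one_div]
  · have e : ∀ z : Fin (2 * 2 ^ n) → ℝ, z (yIdx n j) * z (xIdx n i') = z (xIdx n i') * z (yIdx n j) :=
      fun z => mul_comm _ _
    simp_rw [e]
    rw [integral_x_mul_y, abs_mul, abs_of_nonneg hε, abs_hadamardMatrix, ← div_eq_mul_one_div]
  · rw [integral_y_mul_y]
    have : j ≠ j' := fun h => hkl (h ▸ rfl)
    simpa [this] using hb

/-! #### All moments: `|Ĝ'(S)| ≤ ε^{|S|/2}` (Claim 4.1(4)) -/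

/-- The `x`-part `∏_{i : xᵢ ∈ S} xᵢ` of the monomial `∏_{k∈S} z_k`. [cite: RazTalJACM2022, Claim 4.1] -/
noncomputable def xMonomial (S : Finset (Fin (2 * 2 ^ n))) (z : Fin (2 * 2 ^ n) → ℝ) : ℝ :=
  ∏ i, if xIdx n i ∈ S then z (xIdx n i) else 1

/-- The `y`-part `∏_{j : yⱼ ∈ S} yⱼ` of the monomial `∏_{k∈S} z_k`. [cite: RazTalJACM2022, Claim 4.1] -/
noncomputable def yMonomial (S : Finset (Fin (2 * 2 ^ n))) (z : Fin (2 * 2 ^ n) → ℝ) : ℝ :=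
  ∏ j, if yIdx n j ∈ S then z (yIdx n j) else 1

/-- `∏_{k∈S} z_k = (x-part) · (y-part)`. [folklore] -/
theorem prod_eq_xMonomial_mul_yMonomial (S : Finset (Fin (2 * 2 ^ n))) (z : Fin (2 * 2 ^ n) → ℝ) :
    ∏ k ∈ S, z k = xMonomial n S z * yMonomial n S z := by
  have h : ∏ k ∈ S, z k = ∏ k, (if k ∈ S then z k else 1) := by
    rw [← Finset.prod_filter]; simp
  rw [h, prod_splitIndex]
  rfl

/-- The number of `x`-indices in `S`. [folklore] -/
noncomputable def xCount (S : Finset (Fin (2 * 2 ^ n))) : ℕ :=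
  (Finset.univ.filter fun i => xIdx n i ∈ S).card

/-- The number of `y`-indices in `S`. [folklore] -/
noncomputable def yCount (S : Finset (Fin (2 * 2 ^ n))) : ℕ :=
  (Finset.univ.filter fun j => yIdx n j ∈ S).card

/-- `|S| = #x-indices + #y-indices`. [folklore] -/
theorem xCount_add_yCount (S : Finset (Fin (2 * 2 ^ n))) : xCount n S + yCount n S = S.card := by
  have h : S.card = ∑ k, (if k ∈ S then 1 else 0) := by
    rw [Finset.sum_boole]; simp
  rw [h, sum_splitIndex, xCount, yCount, Finset.card_filter, Finset.card_filter]

/-- `∫ t² d𝒩(0, v) = v`. [folklore] -/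
theorem integral_sq_gaussianReal (v : ℝ≥0) : ∫ t, t ^ 2 ∂(gaussianReal 0 v) = v := by
  have h := variance_of_integral_eq_zero (μ := gaussianReal 0 v) (X := id) aemeasurable_id
    (by simp [integral_id_gaussianReal])
  rw [variance_id_gaussianReal] at h
  simpa using h.symm

/-- **Second moment of a block monomial**: `𝔼_{𝒢'}[(∏_{i∈S_x} xᵢ)²] = ε^{|S_x|}` (independence
within the `x`-half, each `xᵢ ∼ 𝒩(0, ε)`; Raz–Tal, proof of Claim 4.1(4)). [cite: RazTalJACM2022, Claim 4.1] -/
theorem integral_xMonomial_sq (S : Finset (Fin (2 * 2 ^ n))) :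
    ∫ z, xMonomial n S z ^ 2 ∂(razTalGaussian n) = razTalEps (2 ^ n) ^ xCount n S := by
  unfold xMonomial
  have e : ∀ z : Fin (2 * 2 ^ n) → ℝ, (∏ i, (if xIdx n i ∈ S then z (xIdx n i) else 1)) ^ 2 =
      ∏ i, (if xIdx n i ∈ S then z (xIdx n i) ^ 2 else 1) := by
    intro z
    rw [← Finset.prod_pow]
    refine Finset.prod_congr rfl fun i _ => ?_
    split_ifs <;> simp
  simp_rw [e]
  rw [integral_block_razTalGaussian n (map_xBlock_razTalGaussian n)
    (fun x => ∏ i, (if xIdx n i ∈ S then x i ^ 2 else 1)) (Continuous.aestronglyMeasurable ?_)]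
  · unfold blockGaussian
    rw [integral_fintype_prod_eq_prod
      (f := fun (i : Fin (2 ^ n)) (t : ℝ) => if xIdx n i ∈ S then t ^ 2 else 1)]
    have e2 : ∀ i : Fin (2 ^ n), (∫ t, (if xIdx n i ∈ S then t ^ 2 else (1 : ℝ))
        ∂(gaussianReal 0 (razTalEpsNN n))) = if xIdx n i ∈ S then razTalEps (2 ^ n) else 1 := by
      intro i
      split_ifs
      · exact integral_sq_gaussianReal _
      · simp
    simp_rw [e2]
    rw [Finset.prod_ite, Finset.prod_const, Finset.prod_const_one, mul_one, xCount]
  · refine continuous_finsetProd _ fun i _ => ?_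
    split_ifs <;> fun_prop

/-- The same for the `y`-half: `𝔼_{𝒢'}[(∏_{j∈S_y} yⱼ)²] = ε^{|S_y|}`. [cite: RazTalJACM2022, Claim 4.1] -/
theorem integral_yMonomial_sq (S : Finset (Fin (2 * 2 ^ n))) :
    ∫ z, yMonomial n S z ^ 2 ∂(razTalGaussian n) = razTalEps (2 ^ n) ^ yCount n S := by
  unfold yMonomial
  have e : ∀ z : Fin (2 * 2 ^ n) → ℝ, (∏ j, (if yIdx n j ∈ S then z (yIdx n j) else 1)) ^ 2 =
      ∏ j, (if yIdx n j ∈ S then z (yIdx n j) ^ 2 else 1) := by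
    intro z
    rw [← Finset.prod_pow]
    refine Finset.prod_congr rfl fun j _ => ?_
    split_ifs <;> simp
  simp_rw [e]
  rw [integral_block_razTalGaussian n (map_yBlock_razTalGaussian n)
    (fun x => ∏ j, (if yIdx n j ∈ S then x j ^ 2 else 1)) (Continuous.aestronglyMeasurable ?_)]
  · unfold blockGaussian
    rw [integral_fintype_prod_eq_prod
      (f := fun (j : Fin (2 ^ n)) (t : ℝ) => if yIdx n j ∈ S then t ^ 2 else 1)]
    have e2 : ∀ j : Fin (2 ^ n), (∫ t, (if yIdx n j ∈ S then t ^ 2 else (1 : ℝ))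
        ∂(gaussianReal 0 (razTalEpsNN n))) = if yIdx n j ∈ S then razTalEps (2 ^ n) else 1 := by
      intro j
      split_ifs
      · exact integral_sq_gaussianReal _
      · simp
    simp_rw [e2]
    rw [Finset.prod_ite, Finset.prod_const, Finset.prod_const_one, mul_one, yCount]
  · refine continuous_finsetProd _ fun j _ => ?_
    split_ifs <;> fun_prop

/-- Square-integrability of the `x`-part. [folklore] -/
theorem integrable_xMonomial_sq (S : Finset (Fin (2 * 2 ^ n))) :
    Integrable (fun z => xMonomial n S z ^ 2) (razTalGaussian n) := by
  unfold xMonomial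
  have e : ∀ z : Fin (2 * 2 ^ n) → ℝ, (∏ i, (if xIdx n i ∈ S then z (xIdx n i) else 1)) ^ 2 =
      ∏ i, (if xIdx n i ∈ S then z (xIdx n i) ^ 2 else 1) := by
    intro z
    rw [← Finset.prod_pow]
    refine Finset.prod_congr rfl fun i _ => ?_
    split_ifs <;> simp
  simp_rw [e]
  refine integrable_block_razTalGaussian n (map_xBlock_razTalGaussian n)
    (fun x => ∏ i, (if xIdx n i ∈ S then x i ^ 2 else 1)) ?_
  unfold blockGaussian
  refine Integrable.fintype_prod
    (f := fun (i : Fin (2 ^ n)) (t : ℝ) => if xIdx n i ∈ S then t ^ 2 else 1) fun i => ?_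
  split_ifs
  · have := (memLp_id_gaussianReal (μ := 0) (v := razTalEpsNN n) 2).integrable_norm_pow
      (by norm_num)
    simpa using this
  · exact integrable_const _

/-- Square-integrability of the `y`-part. [folklore] -/
theorem integrable_yMonomial_sq (S : Finset (Fin (2 * 2 ^ n))) :
    Integrable (fun z => yMonomial n S z ^ 2) (razTalGaussian n) := by
  unfold yMonomial
  have e : ∀ z : Fin (2 * 2 ^ n) → ℝ, (∏ j, (if yIdx n j ∈ S then z (yIdx n j) else 1)) ^ 2 =
      ∏ j, (if yIdx n j ∈ S then z (yIdx n j) ^ 2 else 1) := by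
    intro z
    rw [← Finset.prod_pow]
    refine Finset.prod_congr rfl fun j _ => ?_
    split_ifs <;> simp
  simp_rw [e]
  refine integrable_block_razTalGaussian n (map_yBlock_razTalGaussian n)
    (fun x => ∏ j, (if yIdx n j ∈ S then x j ^ 2 else 1)) ?_
  unfold blockGaussian
  refine Integrable.fintype_prod
    (f := fun (j : Fin (2 ^ n)) (t : ℝ) => if yIdx n j ∈ S then t ^ 2 else 1) fun j => ?_
  split_ifs
  · have := (memLp_id_gaussianReal (μ := 0) (v := razTalEpsNN n) 2).integrable_norm_pow
      (by norm_num)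
    simpa using this
  · exact integrable_const _

/-- **AM–GM with a weight** (in place of Cauchy–Schwarz in Claim 4.1(4)): for `s > 0`,
`|f g| ≤ ((f s^b)² + (g s^a)²) / (2 s^{a+b})`. [folklore] -/
theorem abs_mul_le_weighted (f g s : ℝ) (hs : 0 < s) (a b : ℕ) :
    |f * g| ≤ ((f * s ^ b) ^ 2 + (g * s ^ a) ^ 2) / (2 * s ^ (a + b)) := by
  have hsab : 0 < s ^ (a + b) := pow_pos hs _
  rw [abs_mul, le_div_iff₀ (by positivity)]
  have h := two_mul_le_add_sq (|f| * s ^ b) (|g| * s ^ a)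
  have e1 : (|f| * s ^ b) ^ 2 = (f * s ^ b) ^ 2 := by rw [mul_pow, mul_pow, sq_abs]
  have e2 : (|g| * s ^ a) ^ 2 = (g * s ^ a) ^ 2 := by rw [mul_pow, mul_pow, sq_abs]
  rw [e1, e2] at h
  calc |f| * |g| * (2 * s ^ (a + b)) = 2 * (|f| * s ^ b) * (|g| * s ^ a) := by rw [pow_add]; ring
    _ ≤ (f * s ^ b) ^ 2 + (g * s ^ a) ^ 2 := h

/-- Monomials are `𝒢'`-integrable (for `n ≥ 1`). [folklore] -/
theorem integrable_monomial {n : ℕ} (hn : 1 ≤ n) (S : Finset (Fin (2 * 2 ^ n))) :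
    Integrable (fun z : Fin (2 * 2 ^ n) → ℝ => ∏ k ∈ S, z k) (razTalGaussian n) := by
  set s : ℝ := Real.sqrt (razTalEps (2 ^ n)) with hsdef
  have hs : 0 < s := Real.sqrt_pos.2 (razTalEps_pos hn)
  set a := xCount n S
  set b := yCount n S
  have hdom : Integrable (fun z => ((xMonomial n S z * s ^ b) ^ 2 + (yMonomial n S z * s ^ a) ^ 2) /
      (2 * s ^ (a + b))) (razTalGaussian n) := by
    refine Integrable.div_const (Integrable.add ?_ ?_) _
    · simp_rw [mul_pow]
      exact (integrable_xMonomial_sq n S).mul_const _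
    · simp_rw [mul_pow]
      exact (integrable_yMonomial_sq n S).mul_const _
  refine hdom.mono' (Continuous.aestronglyMeasurable (by fun_prop)) (ae_of_all _ fun z => ?_)
  rw [Real.norm_eq_abs, prod_eq_xMonomial_mul_yMonomial]
  exact abs_mul_le_weighted _ _ s hs a b

/-- **Claim 4.1(4)** (scaled): `|Ĝ'(S)| ≤ ε^{|S|/2}` for every `S ⊆ [2N]` (Raz–Tal, Claim 4.1(4):
`|Ĝ(S,T)| ≤ 1` by Cauchy–Schwarz and independence within each half; here with the weighted
AM–GM inequality, `n ≥ 1`). [cite: RazTalJACM2022, Claim 4.1] -/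
theorem abs_gaussMoment_le {n : ℕ} (hn : 1 ≤ n) (S : Finset (Fin (2 * 2 ^ n))) :
    |gaussMoment n S| ≤ Real.sqrt (razTalEps (2 ^ n)) ^ S.card := by
  set s : ℝ := Real.sqrt (razTalEps (2 ^ n)) with hsdef
  have hs : 0 < s := Real.sqrt_pos.2 (razTalEps_pos hn)
  have hs2 : s ^ 2 = razTalEps (2 ^ n) := Real.sq_sqrt (razTalEps_nonneg _)
  set a := xCount n S with hadef
  set b := yCount n S with hbdef
  have hab : a + b = S.card := xCount_add_yCount n S
  have hI1 : Integrable (fun z => (xMonomial n S z * s ^ b) ^ 2) (razTalGaussian n) := by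
    simp_rw [mul_pow]; exact (integrable_xMonomial_sq n S).mul_const _
  have hI2 : Integrable (fun z => (yMonomial n S z * s ^ a) ^ 2) (razTalGaussian n) := by
    simp_rw [mul_pow]; exact (integrable_yMonomial_sq n S).mul_const _
  unfold gaussMoment
  calc |∫ z, ∏ k ∈ S, z k ∂(razTalGaussian n)|
      ≤ ∫ z, |∏ k ∈ S, z k| ∂(razTalGaussian n) := abs_integral_le_integral_abs
    _ ≤ ∫ z, ((xMonomial n S z * s ^ b) ^ 2 + (yMonomial n S z * s ^ a) ^ 2) / (2 * s ^ (a + b))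
          ∂(razTalGaussian n) := by
        refine integral_mono_of_nonneg (ae_of_all _ fun z => abs_nonneg _)
          ((hI1.add hI2).div_const _) (ae_of_all _ fun z => ?_)
        simp only
        rw [prod_eq_xMonomial_mul_yMonomial]
        exact abs_mul_le_weighted _ _ s hs a b
    _ = (razTalEps (2 ^ n) ^ a * (s ^ b) ^ 2 + razTalEps (2 ^ n) ^ b * (s ^ a) ^ 2) /
          (2 * s ^ (a + b)) := by
        rw [integral_div, integral_add hI1 hI2]
        simp_rw [mul_pow]
        rw [integral_mul_const, integral_mul_const, integral_xMonomial_sq, integral_yMonomial_sq]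
    _ = s ^ S.card := by
        rw [← hab, ← hs2]
        have hsab : s ^ (a + b) ≠ 0 := pow_ne_zero _ hs.ne'
        field_simp
        ring

end Moments

/-! ### Claim 7.2: one Gaussian step at scale `p` -/

section Claim72

variable {n : ℕ}

/-- The bounds on `|Ĝ'(S)|` by level `k = |S|` used in the proof of Claim 7.2: `ε N^{-1/2}` at
level `2` (Claim 4.1(1)), `0` at odd levels (Claim 4.1(2)), `ε^{k/2}` otherwise (Claim 4.1(4)). [cite: RazTalJACM2022, Claim 7.2] -/
noncomputable def momentBound (n k : ℕ) : ℝ :=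
  if k = 2 then razTalEps (2 ^ n) / Real.sqrt ((2 ^ n : ℕ) : ℝ)
  else if Odd k then 0 else Real.sqrt (razTalEps (2 ^ n)) ^ k

/-- The level bounds are nonnegative. [folklore] -/
theorem momentBound_nonneg (n k : ℕ) : 0 ≤ momentBound n k := by
  unfold momentBound
  have := razTalEps_nonneg (2 ^ n)
  split_ifs <;> positivity

/-- `|Ĝ'(S)| ≤ momentBound |S|` (Claim 4.1 as used in the proof of Claim 7.2). [cite: RazTalJACM2022, Claim 7.2] -/
theorem abs_gaussMoment_le_momentBound (hn : 1 ≤ n) (S : Finset (Fin (2 * 2 ^ n))) :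
    |gaussMoment n S| ≤ momentBound n S.card := by
  unfold momentBound
  split_ifs with h2 hodd
  · obtain ⟨k, l, hkl, rfl⟩ := Finset.card_eq_two.1 h2
    exact abs_gaussMoment_pair_le n hkl
  · rw [gaussMoment_eq_zero_of_odd n S hodd, abs_zero]
  · exact abs_gaussMoment_le hn S

/-- `Ĝ'(∅) = 1`. [folklore] -/
theorem gaussMoment_empty (n : ℕ) : gaussMoment n ∅ = 1 := by
  simp [gaussMoment]

/-- **Expectation of a multilinear function of `P ∘ z`** (Raz–Tal, proof of Claim 7.2, first two
displays): `𝔼_{z∼𝒢'} F(P ∘ z) = ∑_S F̂(S) (∏_{i∈S} Pᵢ) Ĝ'(S)`. [cite: RazTalJACM2022, Claim 7.2] -/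
theorem integral_multilinearEval_smul (hn : 1 ≤ n) (c : Finset (Fin (2 * 2 ^ n)) → ℝ)
    (P : Fin (2 * 2 ^ n) → ℝ) :
    ∫ z, multilinearEval c (fun i => P i * z i) ∂(razTalGaussian n) =
      ∑ S, c S * (∏ i ∈ S, P i) * gaussMoment n S := by
  unfold multilinearEval gaussMoment
  have e : ∀ z : Fin (2 * 2 ^ n) → ℝ, ∑ S, c S * ∏ i ∈ S, P i * z i =
      ∑ S, (c S * ∏ i ∈ S, P i) * ∏ i ∈ S, z i := by
    intro z
    refine Finset.sum_congr rfl fun S _ => ?_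
    rw [Finset.prod_mul_distrib]; ring
  simp_rw [e]
  rw [integral_finsetSum _ fun S _ => (integrable_monomial hn S).const_mul _]
  simp_rw [integral_const_mul]

/-- Integrability of a multilinear function of `P ∘ z`. [folklore] -/
theorem integrable_multilinearEval_smul (hn : 1 ≤ n) (c : Finset (Fin (2 * 2 ^ n)) → ℝ)
    (P : Fin (2 * 2 ^ n) → ℝ) :
    Integrable (fun z => multilinearEval c (fun i => P i * z i)) (razTalGaussian n) := by
  unfold multilinearEval
  have e : ∀ z : Fin (2 * 2 ^ n) → ℝ, ∑ S, c S * ∏ i ∈ S, P i * z i =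
      ∑ S, (c S * ∏ i ∈ S, P i) * ∏ i ∈ S, z i := by
    intro z
    refine Finset.sum_congr rfl fun S _ => ?_
    rw [Finset.prod_mul_distrib]; ring
  simp_rw [e]
  exact integrable_finsetSum _ fun S _ => (integrable_monomial hn S).const_mul _

/-- Summation over subsets of `[m]` by cardinality. [folklore] -/
theorem sum_finset_eq_sum_range_powersetCard {m : ℕ} (h : Finset (Fin m) → ℝ) :
    ∑ S, h S = ∑ k ∈ Finset.range (m + 1), ∑ S ∈ (Finset.univ : Finset (Fin m)).powersetCard k, h S := by
  rw [← Finset.powerset_univ, Finset.powerset_card_disjiUnion, Finset.sum_disjiUnion, Finset.card_univ,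
    Fintype.card_fin]

/-- **Raz–Tal, Claim 7.2** (one Gaussian step). Let `F` be multilinear on `ℝ^{2N}` with level-`k`
Fourier mass `∑_{|S|=k} |F̂(S)| ≤ L^k` for all `k ≥ 1` (for a `{±1}`-valued circuit of size `s`
and depth `d`, `L = (c log s)^{d-1}` by Lemma 7.1), let `P ∈ [-p, p]^{2N}`, and put
`q = p √ε L`. If `q ≤ 1/2` and `q² ≤ N^{-1/2}`, then
`|𝔼_{z∼𝒢'}[F(P ∘ z)] − F(0)| ≤ 3 ε p² L² N^{-1/2}`.
The paper assumes only `q ≤ 1/2` and uses the sharper `|Ĝ(S)| ≤ ℓ! N^{-ℓ/2}` (`|S| = 2ℓ`,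
Isserlis) at levels `4 ≤ |S| ≤ n`; under the extra hypothesis `q² ≤ N^{-1/2}` — which holds in
its only application, the proof of Theorem 7.4, where `q ≤ N^{-1/4}/4` — the levels `≥ 4` are
controlled by Claim 4.1(4) alone: level `2` contributes `q² N^{-1/2}`, odd levels vanish, and
`∑_{k≥4} q^k ≤ 2q⁴ ≤ 2 q² N^{-1/2}`. [cite: RazTalJACM2022, Claim 7.2] -/
theorem razTal_claim72 (hn : 1 ≤ n) (c : Finset (Fin (2 * 2 ^ n)) → ℝ) {L p : ℝ}
    (hL : 0 ≤ L) (hp : 0 ≤ p)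
    (hW : ∀ k, 1 ≤ k → ∑ S ∈ (Finset.univ : Finset (Fin (2 * 2 ^ n))).powersetCard k, |c S| ≤ L ^ k)
    (hq : p * Real.sqrt (razTalEps (2 ^ n)) * L ≤ 1 / 2)
    (hqN : (p * Real.sqrt (razTalEps (2 ^ n)) * L) ^ 2 ≤ 1 / Real.sqrt ((2 ^ n : ℕ) : ℝ))
    (P : Fin (2 * 2 ^ n) → ℝ) (hP : ∀ i, |P i| ≤ p) :
    |∫ z, multilinearEval c (fun i => P i * z i) ∂(razTalGaussian n) - c ∅| ≤
      3 * razTalEps (2 ^ n) * p ^ 2 * L ^ 2 / Real.sqrt ((2 ^ n : ℕ) : ℝ) := by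
  set N : ℝ := ((2 ^ n : ℕ) : ℝ) with hNdef
  set ε : ℝ := razTalEps (2 ^ n) with hεdef
  set s : ℝ := Real.sqrt ε with hsdef
  set q : ℝ := p * s * L with hqdef
  have hε0 : 0 ≤ ε := razTalEps_nonneg _
  have hs2 : s ^ 2 = ε := Real.sq_sqrt hε0
  have hq0 : 0 ≤ q := by positivity
  have hq1 : q < 1 := by linarith
  have hNpos : 0 < N := by positivity
  have hsqN : 0 < Real.sqrt N := Real.sqrt_pos.2 hNpos
  -- Step 1: expand and remove the constant term
  rw [integral_multilinearEval_smul hn c P]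
  set f : Finset (Fin (2 * 2 ^ n)) → ℝ := fun S => c S * (∏ i ∈ S, P i) * gaussMoment n S with hf
  have hf0 : f ∅ = c ∅ := by simp [hf, gaussMoment_empty]
  rw [← Finset.add_sum_erase _ f (Finset.mem_univ ∅), hf0, add_sub_cancel_left]
  -- Step 2: termwise bounds by level
  set lw : ℕ → ℝ := fun k => if k = 0 then 0 else p ^ k * momentBound n k with hlw
  have hlw0 : ∀ k, 0 ≤ lw k := fun k => by
    simp only [hlw]
    split_ifs
    · exact le_rfl
    · exact mul_nonneg (pow_nonneg hp _) (momentBound_nonneg n k)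
  have hterm : ∀ S ∈ (Finset.univ : Finset (Finset (Fin (2 * 2 ^ n)))).erase ∅,
      |f S| ≤ |c S| * lw S.card := by
    intro S hS
    have hne : S ≠ ∅ := Finset.ne_of_mem_erase hS
    have hcard : S.card ≠ 0 := by rwa [Ne, Finset.card_eq_zero]
    simp only [hf, hlw, if_neg hcard]
    rw [abs_mul, abs_mul, mul_assoc]
    refine mul_le_mul_of_nonneg_left ?_ (abs_nonneg _)
    refine mul_le_mul ?_ (abs_gaussMoment_le_momentBound hn S) (abs_nonneg _) (pow_nonneg hp _)
    rw [Finset.abs_prod]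
    calc ∏ i ∈ S, |P i| ≤ ∏ _i ∈ S, p :=
          Finset.prod_le_prod (fun i _ => abs_nonneg _) fun i _ => hP i
      _ = p ^ S.card := Finset.prod_const p
  -- Step 3: the level bounds `lw k · L^k`
  have hlevel : ∀ k : ℕ, lw k * L ^ k ≤
      (if k = 2 then q ^ 2 / Real.sqrt N else 0) + (if 4 ≤ k then q ^ k else 0) := by
    intro k
    simp only [hlw]
    by_cases hk0 : k = 0
    · subst hk0; simp
    rw [if_neg hk0]
    unfold momentBound
    by_cases hk2 : k = 2
    · subst hk2
      simp only [if_true]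
      rw [if_neg (by norm_num : ¬ (4 ≤ 2)), add_zero, hqdef]
      rw [← hNdef, ← hεdef, ← hs2]
      apply le_of_eq
      field_simp
    rw [if_neg hk2, if_neg hk2, zero_add]
    by_cases hodd : Odd k
    · rw [if_pos hodd, mul_zero, zero_mul]
      split_ifs
      · exact pow_nonneg hq0 _
      · exact le_rfl
    · rw [if_neg hodd]
      have h4 : 4 ≤ k := by
        rw [Nat.not_odd_iff_even] at hodd
        obtain ⟨j, rfl⟩ := hodd
        omega
      rw [if_pos h4, hqdef, ← hsdef]
      apply le_of_eq
      ring
  -- Step 4: sum the level bounds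
  have hM : 2 ∈ Finset.range (2 * 2 ^ n + 1) := by
    rw [Finset.mem_range]
    have : 1 ≤ 2 ^ n := Nat.one_le_two_pow
    omega
  have hgeom : ∑ k ∈ Finset.range (2 * 2 ^ n + 1), (if 4 ≤ k then q ^ k else 0) ≤ 2 * q ^ 4 := by
    rw [← Finset.sum_filter]
    have hI : (Finset.range (2 * 2 ^ n + 1)).filter (fun k => 4 ≤ k) = Finset.Ico 4 (2 * 2 ^ n + 1) := by
      ext k
      simp only [Finset.mem_filter, Finset.mem_range, Finset.mem_Ico]
      omega
    rw [hI]
    calc ∑ k ∈ Finset.Ico 4 (2 * 2 ^ n + 1), q ^ k ≤ q ^ 4 / (1 - q) :=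
          geom_sum_Ico_le_of_lt_one hq0 hq1
      _ ≤ 2 * q ^ 4 := by
          rw [div_le_iff₀ (by linarith)]
          nlinarith [pow_nonneg hq0 4]
  have hq4 : q ^ 4 ≤ q ^ 2 * (1 / Real.sqrt N) := by
    rw [show q ^ 4 = q ^ 2 * q ^ 2 by ring]
    exact mul_le_mul_of_nonneg_left hqN (sq_nonneg _)
  calc |∑ S ∈ Finset.univ.erase ∅, f S|
      ≤ ∑ S ∈ Finset.univ.erase ∅, |f S| := Finset.abs_sum_le_sum_abs _ _
    _ ≤ ∑ S ∈ Finset.univ.erase ∅, |c S| * lw S.card := Finset.sum_le_sum hterm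
    _ ≤ ∑ S, |c S| * lw S.card :=
        Finset.sum_le_sum_of_subset_of_nonneg (Finset.erase_subset _ _)
          fun S _ _ => mul_nonneg (abs_nonneg _) (hlw0 _)
    _ = ∑ k ∈ Finset.range (2 * 2 ^ n + 1),
          lw k * ∑ S ∈ (Finset.univ : Finset (Fin (2 * 2 ^ n))).powersetCard k, |c S| := by
        rw [sum_finset_eq_sum_range_powersetCard]
        refine Finset.sum_congr rfl fun k _ => ?_
        rw [Finset.mul_sum]
        refine Finset.sum_congr rfl fun S hS => ?_
        rw [(Finset.mem_powersetCard.1 hS).2, mul_comm]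
    _ ≤ ∑ k ∈ Finset.range (2 * 2 ^ n + 1), lw k * L ^ k := by
        refine Finset.sum_le_sum fun k _ => ?_
        by_cases hk0 : k = 0
        · subst hk0; simp [hlw]
        · exact mul_le_mul_of_nonneg_left (hW k (Nat.one_le_iff_ne_zero.2 hk0)) (hlw0 k)
    _ ≤ ∑ k ∈ Finset.range (2 * 2 ^ n + 1),
          ((if k = 2 then q ^ 2 / Real.sqrt N else 0) + (if 4 ≤ k then q ^ k else 0)) :=
        Finset.sum_le_sum fun k _ => hlevel k
    _ = q ^ 2 / Real.sqrt N + ∑ k ∈ Finset.range (2 * 2 ^ n + 1), (if 4 ≤ k then q ^ k else 0) := by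
        rw [Finset.sum_add_distrib, Finset.sum_ite_eq' _ 2, if_pos hM]
    _ ≤ q ^ 2 / Real.sqrt N + 2 * q ^ 4 := by linarith
    _ ≤ 3 * q ^ 2 / Real.sqrt N := by
        have : q ^ 2 / Real.sqrt N = q ^ 2 * (1 / Real.sqrt N) := by ring
        rw [this] at *
        have e3 : 3 * q ^ 2 / Real.sqrt N = 3 * (q ^ 2 * (1 / Real.sqrt N)) := by ring
        rw [e3]
        linarith
    _ = 3 * ε * p ^ 2 * L ^ 2 / Real.sqrt N := by
        rw [hqdef, ← hs2]; ring

end Claim72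

/-! ### Claim 7.3: a Gaussian step from a base point, by a random restriction -/

section Claim73

variable {m : ℕ}

/-- The values of the random restriction `ρ ∼ R_{z₀}`: `ρᵢ = sgn((z₀)ᵢ)` when fixed, as a bit
(`true ↦ -1`; Raz–Tal, proof of Claim 7.3). [cite: RazTalJACM2022, Claim 7.3] -/
noncomputable def restrictSign (z₀ : Fin m → ℝ) (i : Fin m) : Bool := decide (z₀ i < 0)

/-- `|(z₀)ᵢ| · sgn((z₀)ᵢ) = (z₀)ᵢ`. [folklore] -/
theorem abs_mul_sgn_restrictSign (z₀ : Fin m → ℝ) (i : Fin m) :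
    |z₀ i| * sgn (restrictSign z₀ i) = z₀ i := by
  unfold restrictSign
  by_cases h : z₀ i < 0
  · rw [decide_eq_true h, sgn_true, abs_of_neg h]; ring
  · rw [decide_eq_false h, sgn_false, abs_of_nonneg (not_lt.1 h), mul_one]

/-- The probability that `ρ ∼ R_{z₀}` fixes exactly the coordinates in `J`:
`∏_{i∈J} |(z₀)ᵢ| · ∏_{i∉J} (1 − |(z₀)ᵢ|)` (Raz–Tal, proof of Claim 7.3). [cite: RazTalJACM2022, Claim 7.3] -/
noncomputable def restrictWeight (z₀ : Fin m → ℝ) (J : Finset (Fin m)) : ℝ :=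
  (∏ i ∈ J, |z₀ i|) * ∏ i ∈ Finset.univ \ J, (1 - |z₀ i|)

/-- The scales `Pᵢ = p / (1 − |(z₀)ᵢ|)` of the free coordinates (Raz–Tal, proof of Claim 7.3). [cite: RazTalJACM2022, Claim 7.3] -/
noncomputable def restrictScale (z₀ : Fin m → ℝ) (p : ℝ) (i : Fin m) : ℝ := p / (1 - |z₀ i|)

/-- The point `z̃(z, ρ)`: `ρᵢ` on the fixed coordinates, `Pᵢ zᵢ` on the free ones
(Raz–Tal, proof of Claim 7.3). [cite: RazTalJACM2022, Claim 7.3] -/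
noncomputable def restrictPoint (z₀ : Fin m → ℝ) (p : ℝ) (J : Finset (Fin m)) (z : Fin m → ℝ)
    (i : Fin m) : ℝ :=
  if i ∈ J then sgn (restrictSign z₀ i) else restrictScale z₀ p i * z i

/-- The restriction weights are nonnegative when `z₀ ∈ [-1, 1]^m`. [folklore] -/
theorem restrictWeight_nonneg (z₀ : Fin m → ℝ) (hz₀ : ∀ i, |z₀ i| ≤ 1) (J : Finset (Fin m)) :
    0 ≤ restrictWeight z₀ J := by
  unfold restrictWeight
  refine mul_nonneg (Finset.prod_nonneg fun i _ => abs_nonneg _)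
    (Finset.prod_nonneg fun i _ => ?_)
  linarith [hz₀ i]

/-- The restriction weights sum to `1` (a probability distribution on restrictions). [cite: RazTalJACM2022, Claim 7.3] -/
theorem sum_restrictWeight (z₀ : Fin m → ℝ) : ∑ J, restrictWeight z₀ J = 1 := by
  unfold restrictWeight
  rw [← Finset.powerset_univ, ← Finset.prod_add]
  simp

/-- **`𝔼_ρ ∏_{i∈S} z̃ᵢ = ∏_{i∈S} ((z₀)ᵢ + p zᵢ)`**: under `ρ ∼ R_{z₀}` the coordinates of `z̃(z, ρ)`
are independent with means `(z₀)ᵢ + p zᵢ` (Raz–Tal, proof of Claim 7.3, for `|(z₀)ᵢ| < 1`). [cite: RazTalJACM2022, Claim 7.3] -/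
theorem sum_restrictWeight_mul_prod (z₀ : Fin m → ℝ) (hz₀ : ∀ i, |z₀ i| < 1) (p : ℝ)
    (z : Fin m → ℝ) (S : Finset (Fin m)) :
    ∑ J, restrictWeight z₀ J * ∏ i ∈ S, restrictPoint z₀ p J z i = ∏ i ∈ S, (z₀ i + p * z i) := by
  classical
  set F : Fin m → ℝ := fun i => |z₀ i| * (if i ∈ S then sgn (restrictSign z₀ i) else 1) with hF
  set G : Fin m → ℝ := fun i =>
    (1 - |z₀ i|) * (if i ∈ S then restrictScale z₀ p i * z i else 1) with hG
  -- the right-hand side as `∏ (F + G)`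
  have hFG : ∏ i, (F i + G i) = ∏ i ∈ S, (z₀ i + p * z i) := by
    have e : ∏ i ∈ S, (z₀ i + p * z i) = ∏ i, (if i ∈ S then z₀ i + p * z i else 1) := by
      rw [← Finset.prod_filter]; simp
    rw [e]
    refine Finset.prod_congr rfl fun i _ => ?_
    simp only [hF, hG]
    split_ifs
    · rw [abs_mul_sgn_restrictSign, restrictScale]
      have : 1 - |z₀ i| ≠ 0 := by linarith [hz₀ i]
      field_simp
    · ring
  -- each summand as `(∏_J F)(∏_{Jᶜ} G)`
  have hJ : ∀ J : Finset (Fin m), restrictWeight z₀ J * ∏ i ∈ S, restrictPoint z₀ p J z i =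
      (∏ i ∈ J, F i) * ∏ i ∈ Finset.univ \ J, G i := by
    intro J
    have e1 : ∏ i ∈ S, restrictPoint z₀ p J z i =
        ∏ i, (if i ∈ S then restrictPoint z₀ p J z i else 1) := by
      rw [← Finset.prod_filter]; simp
    have e2 : ∏ i, (if i ∈ S then restrictPoint z₀ p J z i else 1) =
        (∏ i ∈ J, (if i ∈ S then sgn (restrictSign z₀ i) else 1)) *
          ∏ i ∈ Finset.univ \ J, (if i ∈ S then restrictScale z₀ p i * z i else 1) := by
      rw [← Finset.prod_sdiff (Finset.subset_univ J), mul_comm]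
      congr 1
      · refine Finset.prod_congr rfl fun i hi => ?_
        simp only [restrictPoint, if_pos hi]
      · refine Finset.prod_congr rfl fun i hi => ?_
        have hi' : i ∉ J := (Finset.mem_sdiff.1 hi).2
        simp only [restrictPoint, if_neg hi']
    rw [e1, e2, restrictWeight]
    simp only [hF, hG]
    rw [Finset.prod_mul_distrib, Finset.prod_mul_distrib]
    ring
  simp_rw [hJ]
  rw [← hFG, Finset.prod_add, Finset.powerset_univ]

/-- **`𝔼_ρ F(z̃(z, ρ)) = F(z₀ + p z)`** for multilinear `F` (Raz–Tal, proof of Claim 7.3: "since `A`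
is multi-linear and `z̃` has a product distribution"). [cite: RazTalJACM2022, Claim 7.3] -/
theorem sum_restrictWeight_mul_multilinearEval (c : Finset (Fin m) → ℝ) (z₀ : Fin m → ℝ)
    (hz₀ : ∀ i, |z₀ i| < 1) (p : ℝ) (z : Fin m → ℝ) :
    ∑ J, restrictWeight z₀ J * multilinearEval c (restrictPoint z₀ p J z) =
      multilinearEval c (fun i => z₀ i + p * z i) := by
  unfold multilinearEval
  simp_rw [Finset.mul_sum]
  rw [Finset.sum_comm]
  refine Finset.sum_congr rfl fun S _ => ?_
  rw [← sum_restrictWeight_mul_prod z₀ hz₀ p z S, Finset.mul_sum]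
  refine Finset.sum_congr rfl fun J _ => ?_
  ring

variable {n : ℕ}

/-- **Raz–Tal, Claim 7.3** (a Gaussian step from a base point). Let `p ≥ 0`, `z₀ ∈ [-1/2, 1/2]^{2N}`,
and let `g : {±1}^{2N} → ℝ` be such that every restriction `g_{J,σ}` (`σ = sgn z₀`) has level-`k`
Fourier mass `≤ L^k` for all `k ≥ 1` (for a circuit, Lemma 7.1 and "restrictions of `A` are
also Boolean circuits of size at most `s` and depth at most `d`"). If `q = 2p √ε L` satisfies
`q ≤ 1/2` and `q² ≤ N^{-1/2}`, then
`|𝔼_{z∼𝒢'}[g̃(z₀ + p z)] − g̃(z₀)| ≤ 12 ε p² L² N^{-1/2}`, `g̃` the multilinear extension.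
Proof as printed: average over the random restriction `ρ ∼ R_{z₀}`, `g̃(z̃(z,ρ)) = g̃_ρ(P ∘ z)`
with `P ∈ [0, 2p]^{2N}`, and Claim 7.2 for each `g_ρ`. [cite: RazTalJACM2022, Claim 7.3] -/
theorem razTal_claim73 (hn : 1 ≤ n) (g : (Fin (2 * 2 ^ n) → Bool) → ℝ) {L p : ℝ}
    (hL : 0 ≤ L) (hp : 0 ≤ p) (z₀ : Fin (2 * 2 ^ n) → ℝ) (hz₀ : ∀ i, |z₀ i| ≤ 1 / 2)
    (hW : ∀ (J : Finset (Fin (2 * 2 ^ n))) (k : ℕ), 1 ≤ k →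
      ∑ S ∈ (Finset.univ : Finset (Fin (2 * 2 ^ n))).powersetCard k,
        |cubeFourierCoeff (fun x => g (J.piecewise (restrictSign z₀) x)) S| ≤ L ^ k)
    (hq : 2 * p * Real.sqrt (razTalEps (2 ^ n)) * L ≤ 1 / 2)
    (hqN : (2 * p * Real.sqrt (razTalEps (2 ^ n)) * L) ^ 2 ≤ 1 / Real.sqrt ((2 ^ n : ℕ) : ℝ)) :
    |∫ z, multilinearEval (cubeFourierCoeff g) (fun i => z₀ i + p * z i) ∂(razTalGaussian n) -
        multilinearEval (cubeFourierCoeff g) z₀| ≤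
      12 * razTalEps (2 ^ n) * p ^ 2 * L ^ 2 / Real.sqrt ((2 ^ n : ℕ) : ℝ) := by
  set σ := restrictSign z₀ with hσ
  set P := restrictScale z₀ p with hPdef
  set wt := restrictWeight z₀ with hwt
  set cJ : Finset (Fin (2 * 2 ^ n)) → Finset (Fin (2 * 2 ^ n)) → ℝ :=
    fun J => cubeFourierCoeff (fun x => g (J.piecewise σ x)) with hcJ
  have hz₀' : ∀ i, |z₀ i| < 1 := fun i => (hz₀ i).trans_lt (by norm_num)
  have hz₀'' : ∀ i, |z₀ i| ≤ 1 := fun i => (hz₀' i).le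
  have hwt0 : ∀ J, 0 ≤ wt J := restrictWeight_nonneg z₀ hz₀''
  have hP : ∀ i, |P i| ≤ 2 * p := by
    intro i
    simp only [hPdef, restrictScale]
    have h1 : 1 / 2 ≤ 1 - |z₀ i| := by linarith [hz₀ i]
    rw [abs_div, abs_of_nonneg hp, abs_of_pos (by linarith), div_le_iff₀ (by linarith)]
    nlinarith
  -- `g̃(z̃(z, J)) = g̃_J(P ∘ z)`
  have hrestr : ∀ (J : Finset (Fin (2 * 2 ^ n))) (z : Fin (2 * 2 ^ n) → ℝ),
      multilinearEval (cubeFourierCoeff g) (restrictPoint z₀ p J z) =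
        multilinearEval (cJ J) (fun i => P i * z i) := by
    intro J z
    rw [hcJ, multilinearEval_restrict]
    rfl
  -- Step 1: average over restrictions inside the integral and at `z₀`
  have h1 : ∀ z : Fin (2 * 2 ^ n) → ℝ,
      multilinearEval (cubeFourierCoeff g) (fun i => z₀ i + p * z i) =
        ∑ J, wt J * multilinearEval (cJ J) (fun i => P i * z i) := by
    intro z
    rw [← sum_restrictWeight_mul_multilinearEval _ z₀ hz₀' p z]
    simp_rw [hrestr]
    rfl
  have h0 : multilinearEval (cubeFourierCoeff g) z₀ = ∑ J, wt J * cJ J ∅ := by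
    have := h1 (fun _ => 0)
    simp only [mul_zero, add_zero] at this
    rw [this]
    refine Finset.sum_congr rfl fun J _ => ?_
    rw [multilinearEval_zero]
  simp_rw [h1]
  rw [h0, integral_finsetSum _ fun J _ => (integrable_multilinearEval_smul hn (cJ J) P).const_mul _]
  simp_rw [integral_const_mul]
  rw [← Finset.sum_sub_distrib]
  -- Step 2: Claim 7.2 for each restriction
  have h72 : ∀ J, |∫ z, multilinearEval (cJ J) (fun i => P i * z i) ∂(razTalGaussian n) - cJ J ∅| ≤
      3 * razTalEps (2 ^ n) * (2 * p) ^ 2 * L ^ 2 / Real.sqrt ((2 ^ n : ℕ) : ℝ) := by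
    intro J
    refine razTal_claim72 hn (cJ J) hL (by positivity) (fun k hk => ?_) hq hqN P hP
    exact hW J k hk
  calc |∑ J, (wt J * ∫ z, multilinearEval (cJ J) (fun i => P i * z i) ∂(razTalGaussian n) -
          wt J * cJ J ∅)|
      ≤ ∑ J, |wt J * ∫ z, multilinearEval (cJ J) (fun i => P i * z i) ∂(razTalGaussian n) -
          wt J * cJ J ∅| := Finset.abs_sum_le_sum_abs _ _
    _ ≤ ∑ J, wt J * (3 * razTalEps (2 ^ n) * (2 * p) ^ 2 * L ^ 2 / Real.sqrt ((2 ^ n : ℕ) : ℝ)) := by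
        refine Finset.sum_le_sum fun J _ => ?_
        rw [← mul_sub, abs_mul, abs_of_nonneg (hwt0 J)]
        exact mul_le_mul_of_nonneg_left (h72 J) (hwt0 J)
    _ = 12 * razTalEps (2 ^ n) * p ^ 2 * L ^ 2 / Real.sqrt ((2 ^ n : ℕ) : ℝ) := by
        rw [← Finset.sum_mul, hwt, sum_restrictWeight]
        ring

end Claim73

/-! ### Sums of independent Gaussian steps (the random walk of Theorem 7.4) -/

section GaussianSum

/-- The rotation `(x, x') ↦ (a x + b x', -b x + a x')` of `ℝ^N × ℝ^N = ℝ^{[N] ⊔ [N]}`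
(`a² + b² = 1`), as a block matrix. [folklore] -/
noncomputable def rotBlocks (N : ℕ) (a b : ℝ) : Matrix (Fin N ⊕ Fin N) (Fin N ⊕ Fin N) ℝ :=
  Matrix.fromBlocks (a • (1 : Matrix (Fin N) (Fin N) ℝ)) (b • 1) ((-b) • 1) (a • 1)

/-- The rotation is orthogonal. [folklore] -/
theorem rotBlocks_transpose_mul_self (N : ℕ) {a b : ℝ} (hab : a ^ 2 + b ^ 2 = 1) :
    (rotBlocks N a b).transpose * rotBlocks N a b = 1 := by
  unfold rotBlocks
  rw [Matrix.fromBlocks_transpose, Matrix.fromBlocks_multiply]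
  simp only [Matrix.transpose_smul, Matrix.transpose_one, Matrix.smul_mul, Matrix.mul_smul,
    Matrix.one_mul, smul_smul, ← add_smul, ← Matrix.fromBlocks_one]
  congr 1
  all_goals first
    | (rw [← zero_smul ℝ (1 : Matrix (Fin N) (Fin N) ℝ)]; congr 1; ring)
    | (conv_rhs => rw [← one_smul ℝ (1 : Matrix (Fin N) (Fin N) ℝ)]); congr 1; nlinarith

/-- The first block of the rotated vector is `a x + b x'`. [folklore] -/
theorem rotBlocks_mulVec_inl (N : ℕ) (a b : ℝ) (w : Fin N ⊕ Fin N → ℝ) (i : Fin N) :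
    (rotBlocks N a b).mulVec w (Sum.inl i) = a * w (Sum.inl i) + b * w (Sum.inr i) := by
  unfold rotBlocks
  rw [Matrix.fromBlocks_mulVec, Sum.elim_inl]
  simp [Matrix.smul_mulVec, Matrix.one_mulVec]

/-- **Stability of `𝒩(0, I_N)`**: for `x, x'` independent `𝒩(0, I_N)` and `a² + b² = 1`,
`a x + b x' ∼ 𝒩(0, I_N)` (rotation invariance in `ℝ^{2N}`; Raz–Tal, proof of Theorem 7.4:
"`z^{≤(t)} ∼ 𝒢'` since it is a multivariate gaussian with the same expectation and covariance"). [cite: RazTalJACM2022, Thm. 7.4] -/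
theorem stdGaussianPi_prod_map_add (N : ℕ) {a b : ℝ} (hab : a ^ 2 + b ^ 2 = 1) :
    ((stdGaussianPi N).prod (stdGaussianPi N)).map (fun q => a • q.1 + b • q.2) =
      stdGaussianPi N := by
  set μ2 : Measure (Fin N ⊕ Fin N → ℝ) := Measure.pi fun _ => gaussianReal 0 1 with hμ2
  have hpres := measurePreserving_sumPiEquivProdPi (fun _ : Fin N ⊕ Fin N => gaussianReal 0 1)
  have hprod : (stdGaussianPi N).prod (stdGaussianPi N) =
      μ2.map (MeasurableEquiv.sumPiEquivProdPi fun _ : Fin N ⊕ Fin N => ℝ) := by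
    rw [hpres.map_eq]; rfl
  rw [hprod, Measure.map_map (by fun_prop) (MeasurableEquiv.measurable _)]
  have hcomp : (fun q : (Fin N → ℝ) × (Fin N → ℝ) => a • q.1 + b • q.2) ∘
      (MeasurableEquiv.sumPiEquivProdPi fun _ : Fin N ⊕ Fin N => ℝ) =
      (fun w : Fin N ⊕ Fin N → ℝ => fun i => w (Sum.inl i)) ∘ (rotBlocks N a b).mulVec := by
    funext w; funext i
    simp only [Function.comp_apply, Pi.add_apply, Pi.smul_apply, smul_eq_mul, rotBlocks_mulVec_inl]
    rfl
  rw [hcomp, ← Measure.map_map (g := fun w : Fin N ⊕ Fin N → ℝ => fun i => w (Sum.inl i))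
    (f := (rotBlocks N a b).mulVec) (by fun_prop) (Continuous.measurable (by fun_prop))]
  rw [hμ2, pi_gaussianReal_map_mulVec _ (rotBlocks_transpose_mul_self N hab)]
  have hfst : (fun w : Fin N ⊕ Fin N → ℝ => fun i => w (Sum.inl i)) =
      Prod.fst ∘ (MeasurableEquiv.sumPiEquivProdPi fun _ : Fin N ⊕ Fin N => ℝ) := by
    funext w; rfl
  rw [hfst, ← Measure.map_map measurable_fst (MeasurableEquiv.measurable _), hpres.map_eq,
    Measure.map_fst_prod]
  simp [stdGaussianPi]

/-- The general step: `a x + b x' ∼ √(a² + b²) · x` for independent `x, x' ∼ 𝒩(0, I_N)`. [folklore] -/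
theorem stdGaussianPi_prod_map_add' (N : ℕ) {a b : ℝ} (h : 0 < a ^ 2 + b ^ 2) :
    ((stdGaussianPi N).prod (stdGaussianPi N)).map (fun q => a • q.1 + b • q.2) =
      (stdGaussianPi N).map (fun x => Real.sqrt (a ^ 2 + b ^ 2) • x) := by
  set r : ℝ := Real.sqrt (a ^ 2 + b ^ 2) with hr
  have hr0 : 0 < r := Real.sqrt_pos.2 h
  have hcomp : (fun q : (Fin N → ℝ) × (Fin N → ℝ) => a • q.1 + b • q.2) =
      (fun x => r • x) ∘ (fun q : (Fin N → ℝ) × (Fin N → ℝ) => (a / r) • q.1 + (b / r) • q.2) := by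
    funext q
    simp only [Function.comp_apply, smul_add, smul_smul]
    rw [mul_div_cancel₀ _ hr0.ne', mul_div_cancel₀ _ hr0.ne']
  rw [hcomp, ← Measure.map_map (by fun_prop) (by fun_prop), stdGaussianPi_prod_map_add N]
  rw [div_pow, div_pow, ← add_div, hr, Real.sq_sqrt h.le, div_self h.ne']

/-- The sample map is additive. [folklore] -/
theorem razTalSample_add (n : ℕ) (x x' : Fin (2 ^ n) → ℝ) :
    razTalSample n (x + x') = razTalSample n x + razTalSample n x' := by
  funext k
  rw [Pi.add_apply, razTalSample_eq, razTalSample_eq, razTalSample_eq, ← mul_add,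
    ← Finset.sum_add_distrib]
  congr 1
  refine Finset.sum_congr rfl fun i _ => ?_
  rw [Pi.add_apply]; ring

/-- The sample map is homogeneous. [folklore] -/
theorem razTalSample_smul (n : ℕ) (a : ℝ) (x : Fin (2 ^ n) → ℝ) :
    razTalSample n (a • x) = a • razTalSample n x := by
  funext k
  rw [Pi.smul_apply, smul_eq_mul, razTalSample_eq, razTalSample_eq, Finset.mul_sum, Finset.mul_sum,
    Finset.mul_sum]
  refine Finset.sum_congr rfl fun i _ => ?_
  rw [Pi.smul_apply, smul_eq_mul]; ring

/-- **Sums of independent copies of `𝒢'`**: for `z, z'` independent `∼ 𝒢'`,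
`a z + b z' ∼ √(a² + b²) · z` (Raz–Tal, proof of Theorem 7.4: `z^{≤(i)} = p(z^{(1)} + ⋯ + z^{(i)})`
is distributed as `√(i) p · 𝒢'`, and `z^{≤(t)} ∼ 𝒢'`). [cite: RazTalJACM2022, Thm. 7.4] -/
theorem razTalGaussian_prod_map_add (n : ℕ) {a b : ℝ} (h : 0 < a ^ 2 + b ^ 2) :
    ((razTalGaussian n).prod (razTalGaussian n)).map (fun q => a • q.1 + b • q.2) =
      (razTalGaussian n).map (fun z => Real.sqrt (a ^ 2 + b ^ 2) • z) := by
  have hT := (continuous_razTalSample n).measurable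
  rw [razTalGaussian, Measure.map_prod_map _ _ hT hT, Measure.map_map (by fun_prop) (hT.prodMap hT)]
  have hcomp : (fun q : (Fin (2 * 2 ^ n) → ℝ) × (Fin (2 * 2 ^ n) → ℝ) => a • q.1 + b • q.2) ∘
      Prod.map (razTalSample n) (razTalSample n) =
      razTalSample n ∘ (fun q : (Fin (2 ^ n) → ℝ) × (Fin (2 ^ n) → ℝ) => a • q.1 + b • q.2) := by
    funext q
    simp only [Function.comp_apply, Prod.map_fst, Prod.map_snd, razTalSample_add, razTalSample_smul]
  rw [hcomp, ← Measure.map_map hT (by fun_prop), stdGaussianPi_prod_map_add' _ h,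
    Measure.map_map hT (by fun_prop), Measure.map_map (by fun_prop) hT]
  congr 1
  funext x
  simp only [Function.comp_apply, razTalSample_smul]

/-- **One step of the walk as an iterated integral**: for bounded continuous `F`,
`∫∫ F(a z + b z') d𝒢'(z') d𝒢'(z) = ∫ F(√(a²+b²) z) d𝒢'(z)` (Raz–Tal, proof of Theorem 7.4). [cite: RazTalJACM2022, Thm. 7.4] -/
theorem integral_integral_add_razTalGaussian (n : ℕ) {a b : ℝ} (h : 0 < a ^ 2 + b ^ 2)
    (F : (Fin (2 * 2 ^ n) → ℝ) → ℝ) (hF : Continuous F) (hFb : ∀ y, |F y| ≤ 1) :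
    ∫ z, ∫ z', F (a • z + b • z') ∂(razTalGaussian n) ∂(razTalGaussian n) =
      ∫ z, F (Real.sqrt (a ^ 2 + b ^ 2) • z) ∂(razTalGaussian n) := by
  have hint : Integrable (fun q : (Fin (2 * 2 ^ n) → ℝ) × (Fin (2 * 2 ^ n) → ℝ) =>
      F (a • q.1 + b • q.2)) ((razTalGaussian n).prod (razTalGaussian n)) := by
    refine Integrable.mono' (integrable_const (1 : ℝ)) (Continuous.aestronglyMeasurable (by fun_prop))
      (ae_of_all _ fun q => ?_)
    rw [Real.norm_eq_abs]; exact hFb _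
  rw [← integral_prod _ hint,
    ← integral_map (φ := fun q : (Fin (2 * 2 ^ n) → ℝ) × (Fin (2 * 2 ^ n) → ℝ) => a • q.1 + b • q.2)
      (by fun_prop) hF.aestronglyMeasurable,
    razTalGaussian_prod_map_add n h, integral_map (by fun_prop) hF.aestronglyMeasurable]

end GaussianSum

/-! ### Exit probabilities: `Pr_{𝒢'}[∃ k, |z_k| > 1/2] ≤ 4 N^{-2}` -/

section HalfExit

/-- The indicator of leaving the half cube `[-1/2, 1/2]^m` (the complement of the event `Eᵢ` in
the proof of Theorem 7.4): the cube-exit indicator `cubeExitInd` of file `RazTalForrelation` at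
the doubled point. [cite: RazTalJACM2022, Thm. 7.4] -/
noncomputable def halfExitInd {m : ℕ} (z : Fin m → ℝ) : ℝ := cubeExitInd fun k => 2 * z k

/-- The indicator of `|z_k| > 1/2` for one coordinate: `coordTailInd` at the doubled point. [cite: RazTalJACM2022, Thm. 7.4] -/
noncomputable def halfTailInd {m : ℕ} (k : Fin m) (z : Fin m → ℝ) : ℝ := coordTailInd k fun k => 2 * z k

/-- `|2t| > 1 ↔ |t| > 1/2`. [folklore] -/
theorem one_lt_abs_two_mul_iff (t : ℝ) : 1 < |2 * t| ↔ 1 / 2 < |t| := by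
  rw [abs_mul, abs_two]; constructor <;> intro h <;> linarith

/-- `halfExitInd z = 1_{∃k, |z_k| > 1/2}`. [cite: RazTalJACM2022, Thm. 7.4] -/
theorem halfExitInd_eq {m : ℕ} (z : Fin m → ℝ) : halfExitInd z = if ∃ k, 1 / 2 < |z k| then 1 else 0 := by
  unfold halfExitInd cubeExitInd
  simp only [one_lt_abs_two_mul_iff]

/-- `halfTailInd k z = 1_{|z_k| > 1/2}`. [cite: RazTalJACM2022, Thm. 7.4] -/
theorem halfTailInd_eq {m : ℕ} (k : Fin m) (z : Fin m → ℝ) : halfTailInd k z = if 1 / 2 < |z k| then 1 else 0 := by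
  unfold halfTailInd coordTailInd
  simp only [one_lt_abs_two_mul_iff]

/-- `halfExitInd ≥ 0`. [folklore] -/
theorem halfExitInd_nonneg {m : ℕ} (z : Fin m → ℝ) : 0 ≤ halfExitInd z := cubeExitInd_nonneg _

/-- `halfExitInd ≤ 1`. [folklore] -/
theorem halfExitInd_le_one {m : ℕ} (z : Fin m → ℝ) : halfExitInd z ≤ 1 := by
  rw [halfExitInd_eq]; split_ifs <;> norm_num

/-- `halfTailInd ≥ 0`. [folklore] -/
theorem halfTailInd_nonneg {m : ℕ} (k : Fin m) (z : Fin m → ℝ) : 0 ≤ halfTailInd k z := coordTailInd_nonneg _ _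

/-- Inside the half cube the indicator vanishes. [folklore] -/
theorem halfExitInd_eq_zero {m : ℕ} {z : Fin m → ℝ} (h : ∀ k, |z k| ≤ 1 / 2) : halfExitInd z = 0 := by
  rw [halfExitInd_eq, if_neg]
  push Not
  exact h

/-- Union bound: `1_{∃k, |z_k|>1/2} ≤ ∑_k 1_{|z_k|>1/2}` (Raz–Tal, proof of Theorem 7.4; `cubeExitInd_le_sum`
at the doubled point). [cite: RazTalJACM2022, Thm. 7.4] -/
theorem halfExitInd_le_sum {m : ℕ} (z : Fin m → ℝ) : halfExitInd z ≤ ∑ k, halfTailInd k z :=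
  cubeExitInd_le_sum _

/-- Scaling into the cube does not create exits: for `0 ≤ a ≤ 1`,
`1_{∃k, |a z_k|>1/2} ≤ 1_{∃k, |z_k|>1/2}`. [folklore] -/
theorem halfExitInd_smul_le {m : ℕ} {a : ℝ} (ha0 : 0 ≤ a) (ha1 : a ≤ 1) (z : Fin m → ℝ) :
    halfExitInd (a • z) ≤ halfExitInd z := by
  rw [halfExitInd_eq, halfExitInd_eq]
  split_ifs with h1 h2
  · exact le_rfl
  · exfalso
    obtain ⟨k, hk⟩ := h1
    apply h2
    refine ⟨k, hk.trans_le ?_⟩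
    rw [Pi.smul_apply, smul_eq_mul, abs_mul, abs_of_nonneg ha0]
    exact mul_le_of_le_one_left (abs_nonneg _) ha1
  · norm_num
  · exact le_rfl

/-- The exit indicator is measurable (`measurable_cubeExitInd` composed with doubling). [folklore] -/
theorem measurable_halfExitInd {m : ℕ} : Measurable (halfExitInd : (Fin m → ℝ) → ℝ) :=
  measurable_cubeExitInd.comp (by fun_prop)

/-- The one-coordinate indicator is measurable. [folklore] -/
theorem measurable_halfTailInd {m : ℕ} (k : Fin m) : Measurable (halfTailInd k : (Fin m → ℝ) → ℝ) := by
  unfold halfTailInd coordTailInd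
  refine Measurable.ite ?_ measurable_const measurable_const
  exact measurableSet_lt measurable_const (by fun_prop)

/-- The exit indicator is integrable. [folklore] -/
theorem integrable_halfExitInd (n : ℕ) : Integrable halfExitInd (razTalGaussian n) := by
  refine Integrable.mono' (integrable_const (1 : ℝ)) measurable_halfExitInd.aestronglyMeasurable
    (ae_of_all _ fun z => ?_)
  rw [Real.norm_eq_abs, abs_of_nonneg (halfExitInd_nonneg z)]
  exact halfExitInd_le_one z

/-- Exponential domination of the one-dimensional indicator: `1_{|t|>1/2} ≤ e^{ut-u/2} + e^{-ut-u/2}`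
for `u ≥ 0`. [folklore] -/
theorem indicator_half_le_exp (u t : ℝ) (hu : 0 ≤ u) :
    (if 1 / 2 < |t| then (1 : ℝ) else 0) ≤ Real.exp (u * t - u / 2) + Real.exp ((-u) * t - u / 2) := by
  split_ifs with h
  · rcases lt_or_ge 0 t with ht | ht
    · rw [abs_of_pos ht] at h
      have : 1 ≤ Real.exp (u * t - u / 2) := Real.one_le_exp (by nlinarith)
      linarith [Real.exp_pos ((-u) * t - u / 2)]
    · rw [abs_of_nonpos ht] at h
      have : 1 ≤ Real.exp ((-u) * t - u / 2) := Real.one_le_exp (by nlinarith)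
      linarith [Real.exp_pos (u * t - u / 2)]
  · positivity

/-- **Gaussian tail** `Pr[|𝒩(0, v)| > 1/2] ≤ 2 e^{-1/(8v)}` (Raz–Tal, proof of Theorem 7.4:
`Pr[|𝒩(0,ε)| ≥ 1/2] ≤ e^{-1/(8ε)}`, up to the factor `2` of the two-sided bound). [cite: RazTalJACM2022, Thm. 7.4] -/
theorem integral_halfTail_gaussianReal_le (v : ℝ≥0) (hv0 : 0 < (v : ℝ)) :
    ∫ t, (if 1 / 2 < |t| then (1 : ℝ) else 0) ∂(gaussianReal 0 v) ≤ 2 * Real.exp (-(1 / (8 * v))) := by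
  set u : ℝ := 1 / (2 * v) with hu
  have hu0 : 0 ≤ u := by positivity
  calc ∫ t, (if 1 / 2 < |t| then (1 : ℝ) else 0) ∂(gaussianReal 0 v)
      ≤ ∫ t, (Real.exp (u * t - u / 2) + Real.exp ((-u) * t - u / 2)) ∂(gaussianReal 0 v) := by
        apply integral_mono_of_nonneg (ae_of_all _ fun t => by positivity)
        · exact (integrable_exp_mul_sub_gaussianReal v u (u / 2)).add
            (integrable_exp_mul_sub_gaussianReal v (-u) (u / 2))
        · exact ae_of_all _ fun t => indicator_half_le_exp u t hu0
    _ = Real.exp (v * u ^ 2 / 2 - u / 2) + Real.exp (v * (-u) ^ 2 / 2 - u / 2) := by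
        rw [integral_add (integrable_exp_mul_sub_gaussianReal v u (u / 2))
          (integrable_exp_mul_sub_gaussianReal v (-u) (u / 2)),
          integral_exp_mul_sub_gaussianReal, integral_exp_mul_sub_gaussianReal]
    _ = 2 * Real.exp (-(1 / (8 * v))) := by
        have : (v : ℝ) * u ^ 2 / 2 - u / 2 = -(1 / (8 * v)) := by
          rw [hu]; field_simp; ring
        rw [neg_sq, this]; ring

/-- `e^{-1/(8ε)} = N^{-3}` for `ε = 1/(24 ln N)` (Raz–Tal, proof of Theorem 7.4). [cite: RazTalJACM2022, Thm. 7.4] -/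
theorem exp_neg_inv_eight_eps {n : ℕ} (hn : 1 ≤ n) :
    Real.exp (-(1 / (8 * razTalEps (2 ^ n)))) = 1 / ((2 ^ n : ℕ) : ℝ) ^ 3 := by
  have hlog : 0 < Real.log (2 ^ n : ℕ) := by have := half_lt_log_two_pow hn; linarith
  have hN : (0 : ℝ) < (2 ^ n : ℕ) := by positivity
  have h1 : 1 / (8 * razTalEps (2 ^ n)) = (3 : ℕ) * Real.log (2 ^ n : ℕ) := by
    unfold razTalEps
    field_simp
    norm_num
  rw [h1, Real.exp_neg, Real.exp_nat_mul, Real.exp_log hN, one_div]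

/-- The marginal of one coordinate: `∫ 1_{|z_k|>1/2} d𝒢' = ∫ 1_{|t|>1/2} d𝒩(0, ε)`. [cite: RazTalJACM2022, §4.1] -/
theorem integral_halfTailInd (n : ℕ) (k : Fin (2 * 2 ^ n)) :
    ∫ z, halfTailInd k z ∂(razTalGaussian n) =
      ∫ t, (if 1 / 2 < |t| then (1 : ℝ) else 0) ∂(gaussianReal 0 (razTalEpsNN n)) := by
  have hmeas : Measurable fun t : ℝ => if 1 / 2 < |t| then (1 : ℝ) else 0 :=
    Measurable.ite (measurableSet_lt measurable_const (by fun_prop)) measurable_const measurable_const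
  have key : ∀ {e : Fin (2 ^ n) → Fin (2 * 2 ^ n)}
      (_ : (razTalGaussian n).map (fun z i => z (e i)) = blockGaussian n) (i : Fin (2 ^ n)),
      ∫ z, halfTailInd (e i) z ∂(razTalGaussian n) =
        ∫ t, (if 1 / 2 < |t| then (1 : ℝ) else 0) ∂(gaussianReal 0 (razTalEpsNN n)) := by
    intro e he i
    simp_rw [halfTailInd_eq]
    rw [integral_block_razTalGaussian n he (fun x => if 1 / 2 < |x i| then (1 : ℝ) else 0)
      ((hmeas.comp (measurable_pi_apply i)).aestronglyMeasurable)]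
    unfold blockGaussian
    conv_rhs => rw [← (measurePreserving_eval
      (μ := fun _ : Fin (2 ^ n) => gaussianReal 0 (razTalEpsNN n)) i).map_eq]
    rw [integral_map (measurable_pi_apply i).aemeasurable hmeas.aestronglyMeasurable]
  rcases exists_xIdx_or_yIdx n k with ⟨i, rfl⟩ | ⟨j, rfl⟩
  · exact key (map_xBlock_razTalGaussian n) i
  · exact key (map_yBlock_razTalGaussian n) j

/-- **`Pr_{𝒢'}[∃ k, |z_k| > 1/2] ≤ 4 N^{-2}`** (Raz–Tal, proof of Theorem 7.4:
`Pr[E_i] ≥ 1 − 2N · N^{-3}`; here with the two-sided tail, `≤ 2N · 2N^{-3}`), for `n ≥ 1`. [cite: RazTalJACM2022, Thm. 7.4] -/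
theorem integral_halfExitInd_le {n : ℕ} (hn : 1 ≤ n) :
    ∫ z, halfExitInd z ∂(razTalGaussian n) ≤ 4 / ((2 ^ n : ℕ) : ℝ) ^ 2 := by
  set N : ℝ := ((2 ^ n : ℕ) : ℝ) with hNdef
  have hNpos : (0 : ℝ) < N := by positivity
  have hI : ∀ k, Integrable (halfTailInd k) (razTalGaussian n) := fun k => by
    refine Integrable.mono' (integrable_const (1 : ℝ)) (measurable_halfTailInd k).aestronglyMeasurable
      (ae_of_all _ fun z => ?_)
    rw [Real.norm_eq_abs, abs_of_nonneg (halfTailInd_nonneg k z)]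
    rw [halfTailInd_eq]; split_ifs <;> norm_num
  calc ∫ z, halfExitInd z ∂(razTalGaussian n)
      ≤ ∫ z, ∑ k, halfTailInd k z ∂(razTalGaussian n) :=
        integral_mono (integrable_halfExitInd n) (integrable_finsetSum _ fun k _ => hI k)
          fun z => halfExitInd_le_sum z
    _ = ∑ k, ∫ z, halfTailInd k z ∂(razTalGaussian n) := integral_finsetSum _ fun k _ => hI k
    _ ≤ ∑ _k : Fin (2 * 2 ^ n), 2 * (1 / N ^ 3) := by
        refine Finset.sum_le_sum fun k _ => ?_
        rw [integral_halfTailInd, ← exp_neg_inv_eight_eps hn]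
        exact integral_halfTail_gaussianReal_le _ (razTalEps_pos hn)
    _ = (2 * 2 ^ n : ℕ) * (2 * (1 / N ^ 3)) := by
        rw [Finset.sum_const, Finset.card_univ, Fintype.card_fin, nsmul_eq_mul]
    _ = 4 / N ^ 2 := by
        have : ((2 * 2 ^ n : ℕ) : ℝ) = 2 * N := by rw [hNdef]; push_cast; ring
        rw [this]
        field_simp
        ring

end HalfExit

/-! ### Theorem 7.4: the Gaussian random walk -/

section Walk

variable {m n : ℕ}

/-- The truncated multilinear extension `y ↦ F(trnc y)` (Raz–Tal, proof of Theorem 7.4: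
`A(trnc(z^{≤(i)}))`). [cite: RazTalJACM2022, Thm. 7.4] -/
noncomputable def truncEval (c : Finset (Fin m) → ℝ) (y : Fin m → ℝ) : ℝ :=
  multilinearEval c (fun k => trnc (y k))

/-- `y ↦ F(trnc y)` is continuous. [folklore] -/
theorem continuous_truncEval (c : Finset (Fin m) → ℝ) : Continuous (truncEval c) :=
  (continuous_multilinearEval c).comp (continuous_pi fun k => continuous_trnc.comp (continuous_apply k))

/-- `|F(trnc y)| ≤ 1` when `F` is bounded by `1` on the cube (Claim 5.1). [cite: RazTalJACM2022, Claim 5.1] -/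
theorem abs_truncEval_le (c : Finset (Fin m) → ℝ)
    (hc : ∀ w : Fin m → Bool, |multilinearEval c (fun i => sgn (w i))| ≤ 1) (y : Fin m → ℝ) :
    |truncEval c y| ≤ 1 := by
  have h := razTal_claim51 c hc (fun k => trnc (y k))
  rw [maxProd_trnc] at h
  exact h

/-- Inside the cube nothing is truncated. [folklore] -/
theorem truncEval_of_mem_cube (c : Finset (Fin m) → ℝ) {y : Fin m → ℝ} (hy : ∀ k, |y k| ≤ 1) :
    truncEval c y = multilinearEval c y := by
  unfold truncEval
  congr 1
  funext k
  exact trnc_eq_self (hy k)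

/-- At the origin, `F(trnc 0) = F̂(∅)`. [folklore] -/
theorem truncEval_zero (c : Finset (Fin m) → ℝ) : truncEval c (fun _ => 0) = c ∅ := by
  rw [truncEval_of_mem_cube c (fun k => by simp), multilinearEval_zero]

/-- `y ↦ F(trnc y)` composed with an affine map is `𝒢'`-integrable (bounded, continuous). [folklore] -/
theorem integrable_truncEval_affine (n : ℕ) (c : Finset (Fin (2 * 2 ^ n)) → ℝ)
    (hc : ∀ w : Fin (2 * 2 ^ n) → Bool, |multilinearEval c (fun i => sgn (w i))| ≤ 1)
    (z₀ : Fin (2 * 2 ^ n) → ℝ) (p : ℝ) :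
    Integrable (fun z => truncEval c (fun k => z₀ k + p * z k)) (razTalGaussian n) := by
  refine Integrable.mono' (integrable_const (1 : ℝ))
    (Continuous.aestronglyMeasurable ((continuous_truncEval c).comp (by fun_prop)))
    (ae_of_all _ fun z => ?_)
  rw [Real.norm_eq_abs]
  exact abs_truncEval_le c hc _

/-- Multilinear functions of an affine Gaussian are integrable (finite sums of monomials). [folklore] -/
theorem integrable_multilinearEval_affine (hn : 1 ≤ n) (c : Finset (Fin (2 * 2 ^ n)) → ℝ)
    (z₀ : Fin (2 * 2 ^ n) → ℝ) (p : ℝ) :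
    Integrable (fun z => multilinearEval c (fun i => z₀ i + p * z i)) (razTalGaussian n) := by
  unfold multilinearEval
  refine integrable_finsetSum _ fun S _ => ?_
  have e : ∀ z : Fin (2 * 2 ^ n) → ℝ, c S * ∏ i ∈ S, (z₀ i + p * z i) =
      ∑ T ∈ S.powerset, (c S * (∏ i ∈ T, z₀ i) * p ^ (S \ T).card) * ∏ i ∈ S \ T, z i := by
    intro z
    rw [Finset.prod_add, Finset.mul_sum]
    refine Finset.sum_congr rfl fun T _ => ?_
    rw [Finset.prod_mul_distrib, Finset.prod_const]
    ring
  simp_rw [e]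
  exact integrable_finsetSum _ fun T _ => (integrable_monomial hn _).const_mul _

/-- **One step from a base point inside the half cube** (Raz–Tal, proof of Theorem 7.4, the two
displays after "By Claim 7.3"): for `z₀ ∈ [-1/2, 1/2]^{2N}` and `p ≤ 1/2`,
`|𝔼_{z}[F(trnc(z₀ + p z))] − F(trnc z₀)| ≤ 8N^{-2} + 12 ε p² L² N^{-1/2}` (Claim 5.3 with
`p₀ = 1/2` plus Claim 7.3). [cite: RazTalJACM2022, Thm. 7.4] -/
theorem walk_step_inside (hn : 1 ≤ n) (g : (Fin (2 * 2 ^ n) → Bool) → ℝ) (hg : ∀ w, |g w| ≤ 1)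
    {L p : ℝ} (hL : 0 ≤ L) (hp0 : 0 ≤ p) (hp1 : p ≤ 1 / 2)
    (hW : ∀ (J : Finset (Fin (2 * 2 ^ n))) (σ : Fin (2 * 2 ^ n) → Bool) (k : ℕ), 1 ≤ k →
      ∑ S ∈ (Finset.univ : Finset (Fin (2 * 2 ^ n))).powersetCard k,
        |cubeFourierCoeff (fun x => g (J.piecewise σ x)) S| ≤ L ^ k)
    (hq : 2 * p * Real.sqrt (razTalEps (2 ^ n)) * L ≤ 1 / 2)
    (hqN : (2 * p * Real.sqrt (razTalEps (2 ^ n)) * L) ^ 2 ≤ 1 / Real.sqrt ((2 ^ n : ℕ) : ℝ))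
    (z₀ : Fin (2 * 2 ^ n) → ℝ) (hz₀ : ∀ k, |z₀ k| ≤ 1 / 2) :
    |∫ z, truncEval (cubeFourierCoeff g) (fun k => z₀ k + p * z k) ∂(razTalGaussian n) -
        truncEval (cubeFourierCoeff g) z₀| ≤
      8 / ((2 ^ n : ℕ) : ℝ) ^ 2 +
        12 * razTalEps (2 ^ n) * p ^ 2 * L ^ 2 / Real.sqrt ((2 ^ n : ℕ) : ℝ) := by
  set c := cubeFourierCoeff g with hcdef
  have hc : ∀ w : Fin (2 * 2 ^ n) → Bool, |multilinearEval c (fun i => sgn (w i))| ≤ 1 := fun w => by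
    rw [hcdef, multilinearEval_cubeFourierCoeff_sgn]; exact hg w
  have h0 : truncEval c z₀ = multilinearEval c z₀ :=
    truncEval_of_mem_cube c fun k => (hz₀ k).trans (by norm_num)
  have hI1 := integrable_truncEval_affine n c hc z₀ p
  have hI2 := integrable_multilinearEval_affine hn c z₀ p
  have hsplit : ∫ z, truncEval c (fun k => z₀ k + p * z k) ∂(razTalGaussian n) - truncEval c z₀ =
      (∫ z, (truncEval c (fun k => z₀ k + p * z k) -
        multilinearEval c (fun k => z₀ k + p * z k)) ∂(razTalGaussian n)) +
      (∫ z, multilinearEval c (fun k => z₀ k + p * z k) ∂(razTalGaussian n) -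
        multilinearEval c z₀) := by
    rw [integral_sub hI1 hI2, h0]; ring
  rw [hsplit]
  have h53 := razTal_claim53 hn c hc hp0 (by norm_num : (0 : ℝ) ≤ 1 / 2) (by linarith) z₀ hz₀
  have h73 := razTal_claim73 hn g hL hp0 z₀ hz₀ (fun J k hk => hW J _ k hk) hq hqN
  refine (abs_add_le _ _).trans (add_le_add ?_ h73)
  unfold truncEval
  exact abs_integral_le_integral_abs.trans h53

/-- **One step from an arbitrary base point** `z₀ = a z`, `0 ≤ a ≤ 1`: the previous bound plus `2`
on the exit event `{∃ k, |z_k| > 1/2}` (Raz–Tal, proof of Theorem 7.4: "when `Eᵢ` does not hold,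
the difference ... is at most `2`"). [cite: RazTalJACM2022, Thm. 7.4] -/
theorem walk_step_pointwise (hn : 1 ≤ n) (g : (Fin (2 * 2 ^ n) → Bool) → ℝ) (hg : ∀ w, |g w| ≤ 1)
    {L p : ℝ} (hL : 0 ≤ L) (hp0 : 0 ≤ p) (hp1 : p ≤ 1 / 2)
    (hW : ∀ (J : Finset (Fin (2 * 2 ^ n))) (σ : Fin (2 * 2 ^ n) → Bool) (k : ℕ), 1 ≤ k →
      ∑ S ∈ (Finset.univ : Finset (Fin (2 * 2 ^ n))).powersetCard k,
        |cubeFourierCoeff (fun x => g (J.piecewise σ x)) S| ≤ L ^ k)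
    (hq : 2 * p * Real.sqrt (razTalEps (2 ^ n)) * L ≤ 1 / 2)
    (hqN : (2 * p * Real.sqrt (razTalEps (2 ^ n)) * L) ^ 2 ≤ 1 / Real.sqrt ((2 ^ n : ℕ) : ℝ))
    {a : ℝ} (ha0 : 0 ≤ a) (ha1 : a ≤ 1) (z : Fin (2 * 2 ^ n) → ℝ) :
    |∫ z', truncEval (cubeFourierCoeff g) (fun k => a * z k + p * z' k) ∂(razTalGaussian n) -
        truncEval (cubeFourierCoeff g) (fun k => a * z k)| ≤
      (8 / ((2 ^ n : ℕ) : ℝ) ^ 2 +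
        12 * razTalEps (2 ^ n) * p ^ 2 * L ^ 2 / Real.sqrt ((2 ^ n : ℕ) : ℝ)) +
      2 * halfExitInd z := by
  set c := cubeFourierCoeff g with hcdef
  have hc : ∀ w : Fin (2 * 2 ^ n) → Bool, |multilinearEval c (fun i => sgn (w i))| ≤ 1 := fun w => by
    rw [hcdef, multilinearEval_cubeFourierCoeff_sgn]; exact hg w
  have hK : 0 ≤ 8 / ((2 ^ n : ℕ) : ℝ) ^ 2 +
      12 * razTalEps (2 ^ n) * p ^ 2 * L ^ 2 / Real.sqrt ((2 ^ n : ℕ) : ℝ) := by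
    have := razTalEps_nonneg (2 ^ n); positivity
  by_cases h : ∀ k, |a * z k| ≤ 1 / 2
  · have h1 := walk_step_inside hn g hg hL hp0 hp1 hW hq hqN (fun k => a * z k) h
    linarith [halfExitInd_nonneg z]
  · -- outside the half cube: both terms are at most `1`, and `halfExitInd z = 1`
    have hexit : halfExitInd z = 1 := by
      rw [halfExitInd_eq, if_pos]
      push Not at h
      obtain ⟨k, hk⟩ := h
      refine ⟨k, hk.trans_le ?_⟩
      rw [abs_mul, abs_of_nonneg ha0]
      exact mul_le_of_le_one_left (abs_nonneg _) ha1
    rw [hexit, mul_one]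
    have hA : |∫ z', truncEval c (fun k => a * z k + p * z' k) ∂(razTalGaussian n)| ≤ 1 := by
      have := norm_integral_le_of_norm_le_const (μ := razTalGaussian n)
        (f := fun z' => truncEval c (fun k => a * z k + p * z' k)) (C := 1)
        (ae_of_all _ fun z' => by rw [Real.norm_eq_abs]; exact abs_truncEval_le c hc _)
      simpa using this
    have hB : |truncEval c (fun k => a * z k)| ≤ 1 := abs_truncEval_le c hc _
    calc |∫ z', truncEval c (fun k => a * z k + p * z' k) ∂(razTalGaussian n) -
          truncEval c (fun k => a * z k)|
        ≤ |∫ z', truncEval c (fun k => a * z k + p * z' k) ∂(razTalGaussian n)| +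
            |truncEval c (fun k => a * z k)| := abs_sub _ _
      _ ≤ _ := by linarith

/-- The mean `u_i = 𝔼 F(trnc(z^{≤(i)}))` of the walk after `i` of `t` steps: `z^{≤(i)} ∼ √(i/t) · 𝒢'`
(Raz–Tal, proof of Theorem 7.4). [cite: RazTalJACM2022, Thm. 7.4] -/
noncomputable def walkMean (n : ℕ) (c : Finset (Fin (2 * 2 ^ n)) → ℝ) (t i : ℕ) : ℝ :=
  ∫ z, truncEval c (fun k => Real.sqrt ((i : ℝ) / t) * z k) ∂(razTalGaussian n)

/-- `u_0 = F(0) = F̂(∅)`. [cite: RazTalJACM2022, Thm. 7.4] -/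
theorem walkMean_zero (n : ℕ) (c : Finset (Fin (2 * 2 ^ n)) → ℝ) (t : ℕ) : walkMean n c t 0 = c ∅ := by
  unfold walkMean
  simp only [Nat.cast_zero, zero_div, Real.sqrt_zero, zero_mul]
  rw [truncEval_zero, integral_const, smul_eq_mul, probReal_univ, one_mul]

/-- `u_t = 𝔼_{𝒢'} F(trnc z)`. [cite: RazTalJACM2022, Thm. 7.4] -/
theorem walkMean_self (n : ℕ) (c : Finset (Fin (2 * 2 ^ n)) → ℝ) {t : ℕ} (ht : 0 < t) :
    walkMean n c t t = ∫ z, truncEval c z ∂(razTalGaussian n) := by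
  unfold walkMean
  have : ((t : ℝ) / t) = 1 := div_self (by exact_mod_cast ht.ne')
  simp only [this, Real.sqrt_one, one_mul]

/-- **The step `u_{i+1}` as an iterated integral**: `z^{≤(i+1)} = z^{≤(i)} + p z^{(i+1)}` with an
independent `z^{(i+1)} ∼ 𝒢'`, `p = t^{-1/2}` (Raz–Tal, proof of Theorem 7.4). [cite: RazTalJACM2022, Thm. 7.4] -/
theorem walkMean_succ (n : ℕ) (c : Finset (Fin (2 * 2 ^ n)) → ℝ)
    (hc : ∀ w : Fin (2 * 2 ^ n) → Bool, |multilinearEval c (fun i => sgn (w i))| ≤ 1)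
    {t : ℕ} (ht : 0 < t) (i : ℕ) :
    walkMean n c t (i + 1) =
      ∫ z, ∫ z', truncEval c (fun k => Real.sqrt ((i : ℝ) / t) * z k + Real.sqrt (1 / (t : ℝ)) * z' k)
        ∂(razTalGaussian n) ∂(razTalGaussian n) := by
  set a : ℝ := Real.sqrt ((i : ℝ) / t) with ha
  set b : ℝ := Real.sqrt (1 / (t : ℝ)) with hb
  have htpos : (0 : ℝ) < t := by exact_mod_cast ht
  have hab : a ^ 2 + b ^ 2 = ((i + 1 : ℕ) : ℝ) / t := by
    rw [ha, hb, Real.sq_sqrt (by positivity), Real.sq_sqrt (by positivity)]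
    push_cast
    ring
  have hpos : 0 < a ^ 2 + b ^ 2 := by rw [hab]; positivity
  have h := integral_integral_add_razTalGaussian n hpos (truncEval c) (continuous_truncEval c)
    (abs_truncEval_le c hc)
  have e1 : ∀ z z' : Fin (2 * 2 ^ n) → ℝ, a • z + b • z' = fun k => a * z k + b * z' k := by
    intro z z'; funext k; simp [smul_eq_mul]
  have e2 : ∀ z : Fin (2 * 2 ^ n) → ℝ, Real.sqrt (a ^ 2 + b ^ 2) • z =
      fun k => Real.sqrt (((i + 1 : ℕ) : ℝ) / t) * z k := by
    intro z; funext k; simp [smul_eq_mul, hab]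
  simp_rw [e1, e2] at h
  rw [walkMean, ← h]

/-- **The step bound**: `|u_{i+1} − u_i| ≤ 12 ε p² L² N^{-1/2} + 16 N^{-2}` for `i < t`
(Raz–Tal, proof of Theorem 7.4, with `2 Pr[¬Eᵢ] ≤ 8N^{-2}`). [cite: RazTalJACM2022, Thm. 7.4] -/
theorem abs_walkMean_succ_sub_le (hn : 1 ≤ n) (g : (Fin (2 * 2 ^ n) → Bool) → ℝ)
    (hg : ∀ w, |g w| ≤ 1) {L : ℝ} (hL : 0 ≤ L) {t : ℕ} (ht : 0 < t)
    (hp1 : Real.sqrt (1 / (t : ℝ)) ≤ 1 / 2)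
    (hW : ∀ (J : Finset (Fin (2 * 2 ^ n))) (σ : Fin (2 * 2 ^ n) → Bool) (k : ℕ), 1 ≤ k →
      ∑ S ∈ (Finset.univ : Finset (Fin (2 * 2 ^ n))).powersetCard k,
        |cubeFourierCoeff (fun x => g (J.piecewise σ x)) S| ≤ L ^ k)
    (hq : 2 * Real.sqrt (1 / (t : ℝ)) * Real.sqrt (razTalEps (2 ^ n)) * L ≤ 1 / 2)
    (hqN : (2 * Real.sqrt (1 / (t : ℝ)) * Real.sqrt (razTalEps (2 ^ n)) * L) ^ 2 ≤
      1 / Real.sqrt ((2 ^ n : ℕ) : ℝ))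
    {i : ℕ} (hi : i < t) :
    |walkMean n (cubeFourierCoeff g) t (i + 1) - walkMean n (cubeFourierCoeff g) t i| ≤
      12 * razTalEps (2 ^ n) * (1 / (t : ℝ)) * L ^ 2 / Real.sqrt ((2 ^ n : ℕ) : ℝ) +
        16 / ((2 ^ n : ℕ) : ℝ) ^ 2 := by
  set c := cubeFourierCoeff g with hcdef
  set a : ℝ := Real.sqrt ((i : ℝ) / t) with ha
  set p : ℝ := Real.sqrt (1 / (t : ℝ)) with hpdef
  set N : ℝ := ((2 ^ n : ℕ) : ℝ) with hNdef
  have hc : ∀ w : Fin (2 * 2 ^ n) → Bool, |multilinearEval c (fun i => sgn (w i))| ≤ 1 := fun w => by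
    rw [hcdef, multilinearEval_cubeFourierCoeff_sgn]; exact hg w
  have htpos : (0 : ℝ) < t := by exact_mod_cast ht
  have hp0 : 0 ≤ p := Real.sqrt_nonneg _
  have hp2 : p ^ 2 = 1 / (t : ℝ) := Real.sq_sqrt (by positivity)
  have ha0 : 0 ≤ a := Real.sqrt_nonneg _
  have ha1 : a ≤ 1 := by
    rw [ha, Real.sqrt_le_one]
    rw [div_le_one htpos]
    exact_mod_cast hi.le
  -- the two means as integrals over `z`
  set G : (Fin (2 * 2 ^ n) → ℝ) → ℝ :=
    fun z => ∫ z', truncEval c (fun k => a * z k + p * z' k) ∂(razTalGaussian n) with hGdef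
  have hsucc : walkMean n c t (i + 1) = ∫ z, G z ∂(razTalGaussian n) := walkMean_succ n c hc ht i
  have hcur : walkMean n c t i = ∫ z, truncEval c (fun k => a * z k) ∂(razTalGaussian n) := rfl
  have hIG : Integrable G (razTalGaussian n) := by
    refine Integrable.mono' (integrable_const (1 : ℝ)) ?_ (ae_of_all _ fun z => ?_)
    · exact (MeasureTheory.StronglyMeasurable.integral_prod_right'
        (f := fun q : (Fin (2 * 2 ^ n) → ℝ) × (Fin (2 * 2 ^ n) → ℝ) =>
          truncEval c (fun k => a * q.1 k + p * q.2 k))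
        (Continuous.stronglyMeasurable ((continuous_truncEval c).comp (by fun_prop)))).aestronglyMeasurable
    · rw [Real.norm_eq_abs]
      have := norm_integral_le_of_norm_le_const (μ := razTalGaussian n)
        (f := fun z' => truncEval c (fun k => a * z k + p * z' k)) (C := 1)
        (ae_of_all _ fun z' => by rw [Real.norm_eq_abs]; exact abs_truncEval_le c hc _)
      simpa using this
  have hIT : Integrable (fun z => truncEval c (fun k => a * z k)) (razTalGaussian n) := by
    have := integrable_truncEval_affine n c hc (fun _ => 0) a
    simpa using this
  rw [hsucc, hcur, ← integral_sub hIG hIT]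
  -- pointwise bound and integration
  set K : ℝ := 8 / N ^ 2 + 12 * razTalEps (2 ^ n) * p ^ 2 * L ^ 2 / Real.sqrt N with hKdef
  have hpt : ∀ z, ‖G z - truncEval c (fun k => a * z k)‖ ≤ K + 2 * halfExitInd z := fun z => by
    rw [Real.norm_eq_abs]
    exact walk_step_pointwise hn g hg hL hp0 hp1 hW hq hqN ha0 ha1 z
  have hKH : Integrable (fun z => K + 2 * halfExitInd z) (razTalGaussian n) :=
    (integrable_const K).add ((integrable_halfExitInd n).const_mul 2)
  have hbound := norm_integral_le_of_norm_le hKH (ae_of_all _ hpt)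
  rw [Real.norm_eq_abs, integral_add (integrable_const K) ((integrable_halfExitInd n).const_mul 2),
    integral_const, smul_eq_mul, probReal_univ, one_mul, integral_const_mul] at hbound
  have hexit := integral_halfExitInd_le hn
  calc |∫ z, (G z - truncEval c (fun k => a * z k)) ∂(razTalGaussian n)|
      ≤ K + 2 * ∫ z, halfExitInd z ∂(razTalGaussian n) := hbound
    _ ≤ K + 2 * (4 / N ^ 2) := by linarith
    _ = 12 * razTalEps (2 ^ n) * (1 / (t : ℝ)) * L ^ 2 / Real.sqrt N + 16 / N ^ 2 := by
        rw [hKdef, hp2]; ring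

/-- **The walk estimate** (Raz–Tal, proof of Theorem 7.4, last display, with `t = N` steps):
`|𝔼_{𝒢'} F(trnc z) − F(0)| ≤ 12 ε L² N^{-1/2} + 16 N^{-1}`. [cite: RazTalJACM2022, Thm. 7.4] -/
theorem abs_integral_truncEval_sub_le (hn : 2 ≤ n) (g : (Fin (2 * 2 ^ n) → Bool) → ℝ)
    (hg : ∀ w, |g w| ≤ 1) {L : ℝ} (hL : 0 ≤ L)
    (hW : ∀ (J : Finset (Fin (2 * 2 ^ n))) (σ : Fin (2 * 2 ^ n) → Bool) (k : ℕ), 1 ≤ k →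
      ∑ S ∈ (Finset.univ : Finset (Fin (2 * 2 ^ n))).powersetCard k,
        |cubeFourierCoeff (fun x => g (J.piecewise σ x)) S| ≤ L ^ k)
    (hwlog : 16 * (razTalEps (2 ^ n) * L ^ 2) ≤ Real.sqrt ((2 ^ n : ℕ) : ℝ)) :
    |∫ z, truncEval (cubeFourierCoeff g) z ∂(razTalGaussian n) - cubeFourierCoeff g ∅| ≤
      12 * razTalEps (2 ^ n) * L ^ 2 / Real.sqrt ((2 ^ n : ℕ) : ℝ) + 16 / ((2 ^ n : ℕ) : ℝ) := by
  have hn1 : 1 ≤ n := by omega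
  set c := cubeFourierCoeff g with hcdef
  have ht : 0 < 2 ^ n := Nat.two_pow_pos n
  set N : ℝ := ((2 ^ n : ℕ) : ℝ) with hNdef
  have hN4 : (4 : ℝ) ≤ N := by
    rw [hNdef]
    have : (2 ^ 2 : ℕ) ≤ 2 ^ n := Nat.pow_le_pow_right (by norm_num) hn
    exact_mod_cast this
  have hNpos : (0 : ℝ) < N := by linarith
  have hsqN : 2 ≤ Real.sqrt N := by
    rw [show (2 : ℝ) = Real.sqrt 4 by
      rw [show (4 : ℝ) = 2 ^ 2 by norm_num, Real.sqrt_sq (by norm_num)]]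
    exact Real.sqrt_le_sqrt hN4
  have hsqNpos : 0 < Real.sqrt N := by linarith
  have hNN : Real.sqrt N * Real.sqrt N = N := Real.mul_self_sqrt hNpos.le
  have hs1 : Real.sqrt N ≤ N := by nlinarith
  set ε : ℝ := razTalEps (2 ^ n) with hεdef
  have hε0 : 0 ≤ ε := razTalEps_nonneg _
  set p : ℝ := Real.sqrt (1 / N) with hpdef
  have hp0 : 0 ≤ p := Real.sqrt_nonneg _
  have hp2 : p ^ 2 = 1 / N := by rw [hpdef, Real.sq_sqrt (by positivity)]
  have hp1 : p ≤ 1 / 2 := by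
    have hle : p ^ 2 ≤ (1 / 2) ^ 2 := by
      rw [hp2, div_le_iff₀ hNpos]; nlinarith
    exact (pow_le_pow_iff_left₀ hp0 (by norm_num) two_ne_zero).1 hle
  -- `q = 2 p √ε L`: `q² = 4 ε L² / N ≤ N^{-1/2} / 4`
  have hq2 : (2 * p * Real.sqrt ε * L) ^ 2 = 4 * (ε * L ^ 2) / N := by
    rw [mul_pow, mul_pow, mul_pow, Real.sq_sqrt hε0, hp2]; ring
  have hqN : (2 * p * Real.sqrt ε * L) ^ 2 ≤ 1 / Real.sqrt N := by
    rw [hq2, div_le_div_iff₀ hNpos hsqNpos]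
    nlinarith
  have hq : 2 * p * Real.sqrt ε * L ≤ 1 / 2 := by
    have hq0 : 0 ≤ 2 * p * Real.sqrt ε * L := by positivity
    have hle : (2 * p * Real.sqrt ε * L) ^ 2 ≤ (1 / 2) ^ 2 := by
      rw [hq2, div_le_iff₀ hNpos]
      linarith
    exact (pow_le_pow_iff_left₀ hq0 (by norm_num) two_ne_zero).1 hle
  -- telescoping over the `t = N` steps
  have hstep : ∀ i ∈ Finset.range (2 ^ n),
      |walkMean n c (2 ^ n) (i + 1) - walkMean n c (2 ^ n) i| ≤
        12 * ε * (1 / N) * L ^ 2 / Real.sqrt N + 16 / N ^ 2 := fun i hi =>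
    abs_walkMean_succ_sub_le hn1 g hg hL ht hp1 hW hq hqN (Finset.mem_range.1 hi)
  have htele := Finset.sum_range_sub (walkMean n c (2 ^ n)) (2 ^ n)
  rw [walkMean_self n c ht, walkMean_zero] at htele
  rw [← htele]
  calc |∑ i ∈ Finset.range (2 ^ n), (walkMean n c (2 ^ n) (i + 1) - walkMean n c (2 ^ n) i)|
      ≤ ∑ i ∈ Finset.range (2 ^ n), |walkMean n c (2 ^ n) (i + 1) - walkMean n c (2 ^ n) i| :=
        Finset.abs_sum_le_sum_abs _ _
    _ ≤ ∑ _i ∈ Finset.range (2 ^ n), (12 * ε * (1 / N) * L ^ 2 / Real.sqrt N + 16 / N ^ 2) :=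
        Finset.sum_le_sum hstep
    _ = N * (12 * ε * (1 / N) * L ^ 2 / Real.sqrt N + 16 / N ^ 2) := by
        rw [Finset.sum_const, Finset.card_range, nsmul_eq_mul, hNdef]
    _ = 12 * ε * L ^ 2 / Real.sqrt N + 16 / N := by
        field_simp

end Walk

/-! ### Eq. (2) in general, Lemma 7.1 for restrictions, and the assembly of Theorem 7.4 -/

section Assembly

variable {n : ℕ}

/-- Products of truncated coordinates are `𝒢'`-integrable (bounded by `1`, continuous). [folklore] -/
theorem integrable_prod_trnc (n : ℕ) (S : Finset (Fin (2 * 2 ^ n))) :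
    Integrable (fun z : Fin (2 * 2 ^ n) → ℝ => ∏ i ∈ S, trnc (z i)) (razTalGaussian n) := by
  refine Integrable.mono' (integrable_const (1 : ℝ))
    (Continuous.aestronglyMeasurable
      (continuous_finsetProd S fun i _ => continuous_trnc.comp (continuous_apply i)))
    (ae_of_all _ fun z => ?_)
  rw [Real.norm_eq_abs, Finset.abs_prod]
  exact Finset.prod_le_one (fun i _ => abs_nonneg _) fun i _ => abs_trnc_le_one _

/-- **Eq. (2) of Raz–Tal** for an arbitrary `g : {±1}^{2N} → ℝ`:
`𝔼_{w∼𝒟} g(w) = 𝔼_{z∼𝒢'} g̃(trnc z)`, `g̃` the multilinear extension (Raz–Tal, §5, Eq. (2), by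
linearity from the characters, `charMean_razTalDistribution`). [cite: RazTalJACM2022, §5 Eq. (2)] -/
theorem sum_razTalDistribution_mul (n : ℕ) (g : (Fin (2 * 2 ^ n) → Bool) → ℝ) :
    ∑ w, (razTalDistribution n w).toReal * g w =
      ∫ z, truncEval (cubeFourierCoeff g) z ∂(razTalGaussian n) := by
  have hinv : ∀ w, g w = ∑ S, cubeFourierCoeff g S * walsh S w :=
    fun w => (sum_cubeFourierCoeff_mul_walsh g w).symm
  have e0 : ∑ w, (razTalDistribution n w).toReal * g w =
      ∑ w, ∑ S, (razTalDistribution n w).toReal * (cubeFourierCoeff g S * walsh S w) := by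
    refine Finset.sum_congr rfl fun w _ => ?_
    rw [← Finset.mul_sum, ← hinv w]
  rw [e0, Finset.sum_comm]
  have e : ∀ S, ∑ w, (razTalDistribution n w).toReal * (cubeFourierCoeff g S * walsh S w) =
      cubeFourierCoeff g S * charMean (razTalDistribution n) S := by
    intro S
    rw [charMean, Finset.mul_sum]
    refine Finset.sum_congr rfl fun w _ => ?_
    ring
  simp_rw [e, charMean_razTalDistribution]
  unfold truncEval multilinearEval
  rw [integral_finsetSum _ fun S _ => (integrable_prod_trnc n S).const_mul _]
  simp_rw [integral_const_mul]

/-- **Bridge between the two restriction encodings**: the partial assignment fixing the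
coordinates in `J` to `σ` (`Literature.Computability.Complexity.restrictInput`, file `CircuitRestriction`) acts on inputs
as Mathlib's `J.piecewise σ` (the form used in file `BooleanFourier`). [folklore] -/
theorem restrictInput_ofPiecewise {m : ℕ} (J : Finset (Fin m)) (σ x : Fin m → Bool) :
    restrictInput (fun i => if i ∈ J then some (σ i) else none) x = J.piecewise σ x := by
  funext i
  simp only [restrictInput, Finset.piecewise]
  split_ifs <;> rfl

/-- **Lemma 7.1 for restrictions, from Lemma 7.1** (Raz–Tal, proof of Claim 7.3, first paragraph:
"restrictions of `A` are also Boolean circuits of size at most `s` and depth at most `d`", so that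
Lemma 7.1 applies to every restriction `A_ρ`). In H21's straight-line model restrictions of circuits
over `acBasis` are circuits over `acBasis` of size `≤ max(s, 1) = s` and `acDepth ≤ max(d, 1)`
(`Circuit.exists_restrict`: hard-wiring an input costs a constant gate `∧₀`/`∨₀` of weight `1`),
and `(c log s)^{(max(d,1) - 1) k} = (c log s)^{(d-1)k}`; so Tal's bound holds, with the same
constant, for all restricted functions `x ↦ F(x|_{J←σ})`. [cite: RazTalJACM2022, Claim 7.3] -/
theorem tal2017_fourierL1_ac0_restr_of_plain (h : Tal2017_fourierL1_ac0) :
    ∃ c : ℝ, 0 < c ∧ ∀ (m : ℕ) (F : Circuit (Fin m)) (d s : ℕ), F.IsOver acBasis → F.acDepth ≤ d →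
      F.size ≤ s → 2 ≤ s → ∀ (J : Finset (Fin m)) (σ : Fin m → Bool) (k : ℕ),
        fourierL1Level (fun x => F.eval (J.piecewise σ x)) k ≤ (c * Real.log s) ^ ((d - 1) * k) := by
  obtain ⟨c, hc, h⟩ := h
  refine ⟨c, hc, fun m F d s hB hd hs h2 J σ k => ?_⟩
  obtain ⟨F', hB', hsize, hdepth, heval⟩ :=
    F.exists_restrict hB (fun i => if i ∈ J then some (σ i) else none)
  have hev : (fun x => F.eval (J.piecewise σ x)) = F'.eval := by
    funext x
    rw [heval, restrictInput_ofPiecewise]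
  rw [hev]
  have hsize' : F'.size ≤ s := hsize.trans (max_le (hs.trans le_rfl) (by omega))
  have hdepth' : F'.acDepth ≤ max d 1 := hdepth.trans (max_le_max hd le_rfl)
  have h1 := h m F' (max d 1) s hB' hdepth' hsize' h2 k
  have hexp : max d 1 - 1 = d - 1 := by omega
  rwa [hexp] at h1

/-- `181 n² ≤ 2ⁿ` for `n ≥ 20`. [folklore] -/
theorem sq_le_two_pow_of_le {n : ℕ} (hn : 20 ≤ n) : 181 * n ^ 2 ≤ 2 ^ n := by
  induction n, hn using Nat.le_induction with
  | base => norm_num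
  | succ k hk ih =>
    have h3 : (k + 1) ^ 2 ≤ 2 * k ^ 2 := by nlinarith
    calc 181 * (k + 1) ^ 2 ≤ 181 * (2 * k ^ 2) := Nat.mul_le_mul_left _ h3
      _ = 2 * (181 * k ^ 2) := by ring
      _ ≤ 2 * 2 ^ k := Nat.mul_le_mul_left _ ih
      _ = 2 ^ (k + 1) := by ring

/-- The numerical step closing the proof of Theorem 7.4 (`12 N^{-1} ≤ 20 ε (c log s)^{2(d-1)} N^{-1/2}`
in the paper; here `8 N^{-1} ≤ 10 ε N^{-1/2}`, valid once `19.2 ln N ≤ √N`, e.g. `n ≥ 20`). [cite: RazTalJACM2022, Thm. 7.4] -/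
theorem eight_div_le_ten_eps {n : ℕ} (hn : 20 ≤ n) :
    8 / ((2 ^ n : ℕ) : ℝ) ≤ 10 * razTalEps (2 ^ n) / Real.sqrt ((2 ^ n : ℕ) : ℝ) := by
  set N : ℝ := ((2 ^ n : ℕ) : ℝ) with hNdef
  have hN2 : N = 2 ^ n := by rw [hNdef]; push_cast; ring
  have hN : (0 : ℝ) < N := by rw [hN2]; positivity
  have hsqN : 0 < Real.sqrt N := Real.sqrt_pos.2 hN
  have hlogN : Real.log N = n * Real.log 2 := by rw [hN2, Real.log_pow]
  have hlog2 := Real.log_two_lt_d9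
  have hlog2' := Real.log_two_gt_d9
  have hn' : (20 : ℝ) ≤ n := by exact_mod_cast hn
  have hlogNpos : 0 < Real.log N := by rw [hlogN]; positivity
  -- `19.2 ln N ≤ √N`
  have hkey : (96 / 5) * Real.log N ≤ Real.sqrt N := by
    have hsq : ((96 / 5) * Real.log N) ^ 2 ≤ N := by
      rw [hlogN, hN2]
      have hnat : (181 : ℝ) * (n : ℝ) ^ 2 ≤ 2 ^ n := by exact_mod_cast sq_le_two_pow_of_le hn
      have hl2sq : Real.log 2 ^ 2 ≤ 0.4805 := by nlinarith
      have hmul := mul_le_mul_of_nonneg_left hl2sq (sq_nonneg (n : ℝ))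
      nlinarith
    calc (96 / 5) * Real.log N = Real.sqrt (((96 / 5) * Real.log N) ^ 2) :=
          (Real.sqrt_sq (by positivity)).symm
      _ ≤ Real.sqrt N := Real.sqrt_le_sqrt hsq
  have hprod : Real.log N * Real.sqrt N ≤ (5 / 96) * N := by
    calc Real.log N * Real.sqrt N ≤ ((5 / 96) * Real.sqrt N) * Real.sqrt N := by
          apply mul_le_mul_of_nonneg_right _ hsqN.le
          linarith
      _ = (5 / 96) * N := by rw [mul_assoc, Real.mul_self_sqrt hN.le]
  have hε : razTalEps (2 ^ n) = 1 / (24 * Real.log N) := by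
    unfold razTalEps; rw [hNdef]
  rw [hε, div_le_div_iff₀ hN hsqN]
  rw [show 10 * (1 / (24 * Real.log N)) * N = 10 * N / (24 * Real.log N) by ring,
    le_div_iff₀ (by positivity)]
  nlinarith

/-- **Raz–Tal, Theorem 7.4, from Lemma 7.1** (restriction-closed form): `𝒟` fools bounded-depth
circuits, `|𝔼_{𝒟} A − 𝔼_U A| ≤ 16 ε (c log s)^{2(d-1)} N^{-1/2}` in acceptance probability for
`n ≥ 20`, with `c = max(c_Tal, 2)`. Proof as printed (§7): Eq. (2), the `N`-step Gaussian walk with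
Claims 5.3, 7.2, 7.3 and the exit bound, and the closing numerical estimate; the case
`16 ε L² > √N` is the paper's "otherwise the claim is vacuous". [cite: RazTalJACM2022, Thm. 7.4] -/
theorem razTal2022_thm74_of_tal_restr (cT : ℝ) (hcT : 0 < cT)
    (hT : ∀ (m : ℕ) (F : Circuit (Fin m)) (d s : ℕ), F.IsOver acBasis → F.acDepth ≤ d →
      F.size ≤ s → 2 ≤ s → ∀ (J : Finset (Fin m)) (σ : Fin m → Bool) (k : ℕ),
        fourierL1Level (fun x => F.eval (J.piecewise σ x)) k ≤ (cT * Real.log s) ^ ((d - 1) * k)) :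
    RazTal2022_thm74 := by
  refine ⟨max cT 2, by positivity, 20, fun n hn F d s hB hd hs h2 => ?_⟩
  set c : ℝ := max cT 2 with hcdef
  set N : ℝ := ((2 ^ n : ℕ) : ℝ) with hNdef
  set ε : ℝ := razTalEps (2 ^ n) with hεdef
  set g : (Fin (2 * 2 ^ n) → Bool) → ℝ := fun w => sgn (F.eval w) with hgdef
  set L : ℝ := (c * Real.log s) ^ (d - 1) with hLdef
  have hn2 : 2 ≤ n := by omega
  have hNpos : (0 : ℝ) < N := by positivity
  have hsqNpos : 0 < Real.sqrt N := Real.sqrt_pos.2 hNpos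
  have hε0 : 0 ≤ ε := razTalEps_nonneg _
  have hs2 : (2 : ℝ) ≤ s := by exact_mod_cast h2
  have hlogs : 0 ≤ Real.log s := Real.log_nonneg (by linarith)
  have hlog2 : Real.log 2 ≤ Real.log s := Real.log_le_log two_pos hs2
  have hcl : 1 ≤ c * Real.log s := by
    have h2c : (2 : ℝ) ≤ c := le_max_right _ _
    have := Real.log_two_gt_d9
    nlinarith
  have hL1 : 1 ≤ L := one_le_pow₀ hcl
  have hL0 : 0 ≤ L := by linarith
  have hg1 : ∀ w, |g w| ≤ 1 := fun w => by
    simp only [hgdef, sgn]; split_ifs <;> simp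
  -- Lemma 7.1 for the restrictions of `F`
  have hW : ∀ (J : Finset (Fin (2 * 2 ^ n))) (σ : Fin (2 * 2 ^ n) → Bool) (k : ℕ), 1 ≤ k →
      ∑ S ∈ (Finset.univ : Finset (Fin (2 * 2 ^ n))).powersetCard k,
        |cubeFourierCoeff (fun x => g (J.piecewise σ x)) S| ≤ L ^ k := by
    intro J σ k _
    have h1 := hT (2 * 2 ^ n) F d s hB hd hs h2 J σ k
    rw [fourierL1Level] at h1
    refine h1.trans ?_
    rw [hLdef, ← pow_mul]
    exact pow_le_pow_left₀ (by positivity) (mul_le_mul_of_nonneg_right (le_max_left _ _) hlogs) _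
  -- the two expectations of `g`
  have hED : ∑ w, (razTalDistribution n w).toReal * g w =
      ∫ z, truncEval (cubeFourierCoeff g) z ∂(razTalGaussian n) := sum_razTalDistribution_mul n g
  have hEU : (∑ w, g w) / 2 ^ (2 * 2 ^ n) = cubeFourierCoeff g ∅ := (cubeFourierCoeff_empty g).symm
  -- acceptance indicator versus sign
  have hind : ∀ w, (if F.eval w then (1 : ℝ) else 0) = (1 - g w) / 2 := fun w => by
    simp only [hgdef, sgn]; split_ifs <;> norm_num
  set A := ∑ w, (razTalDistribution n w).toReal * g w with hA
  set B := ∑ w : Fin (2 * 2 ^ n) → Bool, g w with hB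
  have hDsum : ∑ w, (razTalDistribution n w).toReal = 1 := sum_toReal_eq_one _
  have hcard : ((Finset.univ : Finset (Fin (2 * 2 ^ n) → Bool)).card : ℝ) = 2 ^ (2 * 2 ^ n) := by
    rw [Finset.card_univ, Fintype.card_fun, Fintype.card_bool, Fintype.card_fin]
    push_cast; ring
  have hLHS : ∑ w, (razTalDistribution n w).toReal * (if F.eval w then (1 : ℝ) else 0) -
      (∑ w : Fin (2 * 2 ^ n) → Bool, if F.eval w then (1 : ℝ) else 0) / 2 ^ (2 * 2 ^ n) =
      -(A - B / 2 ^ (2 * 2 ^ n)) / 2 := by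
    simp_rw [hind]
    have e1 : ∑ w, (razTalDistribution n w).toReal * ((1 - g w) / 2) = (1 - A) / 2 := by
      have : ∀ w, (razTalDistribution n w).toReal * ((1 - g w) / 2) =
          ((razTalDistribution n w).toReal - (razTalDistribution n w).toReal * g w) / 2 := fun w => by ring
      simp_rw [this]
      rw [← Finset.sum_div, Finset.sum_sub_distrib, hDsum]
    have e2 : ∑ w : Fin (2 * 2 ^ n) → Bool, (1 - g w) / 2 = (2 ^ (2 * 2 ^ n) - B) / 2 := by
      rw [← Finset.sum_div, Finset.sum_sub_distrib, Finset.sum_const, nsmul_eq_mul, mul_one, hcard]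
    rw [e1, e2]
    field_simp
    ring
  rw [hLHS, abs_div, abs_neg, abs_two]
  have hpow : (c * Real.log s) ^ (2 * (d - 1)) = L ^ 2 := by rw [hLdef, ← pow_mul']
  rw [hpow]
  by_cases hw : 16 * (ε * L ^ 2) ≤ Real.sqrt N
  · -- the main case: the walk estimate and the closing numerics
    have hcore := abs_integral_truncEval_sub_le hn2 g hg1 hL0 hW hw
    rw [← hED, ← hEU] at hcore
    have hnum : 8 / N ≤ 10 * ε / Real.sqrt N := eight_div_le_ten_eps hn
    have hnum' : 10 * ε / Real.sqrt N ≤ 10 * ε * L ^ 2 / Real.sqrt N := by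
      apply div_le_div_of_nonneg_right _ hsqNpos.le
      have : 10 * ε * 1 ≤ 10 * ε * L ^ 2 := by
        apply mul_le_mul_of_nonneg_left _ (by positivity); nlinarith
      linarith
    calc |A - B / 2 ^ (2 * 2 ^ n)| / 2 ≤ (12 * ε * L ^ 2 / Real.sqrt N + 16 / N) / 2 :=
          div_le_div_of_nonneg_right hcore zero_le_two
      _ = 6 * ε * L ^ 2 / Real.sqrt N + 8 / N := by ring
      _ ≤ 6 * ε * L ^ 2 / Real.sqrt N + 10 * ε * L ^ 2 / Real.sqrt N := by linarith
      _ = 16 * ε * L ^ 2 / Real.sqrt N := by ring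
  · -- otherwise the bound exceeds `1` and holds trivially
    push Not at hw
    have hR : 1 < 16 * ε * L ^ 2 / Real.sqrt N := by
      rw [lt_div_iff₀ hsqNpos]; linarith
    have hA1 : |A| ≤ 1 := by
      rw [hA]
      calc |∑ w, (razTalDistribution n w).toReal * g w|
          ≤ ∑ w, |(razTalDistribution n w).toReal * g w| := Finset.abs_sum_le_sum_abs _ _
        _ ≤ ∑ w, (razTalDistribution n w).toReal := by
            refine Finset.sum_le_sum fun w _ => ?_
            rw [abs_mul, abs_of_nonneg ENNReal.toReal_nonneg]
            exact mul_le_of_le_one_right ENNReal.toReal_nonneg (hg1 w)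
        _ = 1 := hDsum
    have hB1 : |B / 2 ^ (2 * 2 ^ n)| ≤ 1 := by
      rw [abs_div, abs_of_pos (by positivity : (0 : ℝ) < 2 ^ (2 * 2 ^ n)), div_le_one (by positivity),
        hB]
      calc |∑ w : Fin (2 * 2 ^ n) → Bool, g w| ≤ ∑ w : Fin (2 * 2 ^ n) → Bool, |g w| :=
            Finset.abs_sum_le_sum_abs _ _
        _ ≤ ∑ _w : Fin (2 * 2 ^ n) → Bool, (1 : ℝ) := Finset.sum_le_sum fun w _ => hg1 w
        _ = 2 ^ (2 * 2 ^ n) := by rw [Finset.sum_const, nsmul_eq_mul, mul_one, hcard]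
    calc |A - B / 2 ^ (2 * 2 ^ n)| / 2 ≤ (|A| + |B / 2 ^ (2 * 2 ^ n)|) / 2 :=
          div_le_div_of_nonneg_right (abs_sub _ _) zero_le_two
      _ ≤ 1 := by linarith
      _ ≤ 16 * ε * L ^ 2 / Real.sqrt N := hR.le

/-- **Raz–Tal, Theorem 7.4 from Lemma 7.1** (as printed: Tal 2017, Thm 37, for circuits; named
fact `Tal2017_fourierL1_ac0`). [cite: RazTalJACM2022, Thm. 7.4] -/
theorem razTal2022_thm74_of_tal (h : Tal2017_fourierL1_ac0) : RazTal2022_thm74 := by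
  obtain ⟨c, hc, hT⟩ := tal2017_fourierL1_ac0_restr_of_plain h
  exact razTal2022_thm74_of_tal_restr c hc hT

/-- **quantum-advantage.S15 from Tal's Fourier tail bound for AC⁰** (Raz–Tal, Theorem 1.1, with
Lemma 7.1 = Tal 2017, Thm 37, as its only remaining input). [cite: RazTalJACM2022, Thm. 1.1] -/
theorem raz_tal_forrelation_of_tal (h : Tal2017_fourierL1_ac0) : raz_tal_forrelation :=
  raz_tal_forrelation_of_thm74 (razTal2022_thm74_of_tal h)

end Assembly

end Literature.Computability.QuantumComplexity
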